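import Literature.MathematicalPhysics.QuantumFieldTheory.Balaban1983to89.B3Taylor310Lattice
import Literature.MathematicalPhysics.QuantumFieldTheory.Balaban1983to89.B3Ineq314Cubes

/-!
# `Balaban1983to89.B3Ineq313Lattice` — T. Bałaban, *(Higgs)₂,₃ quantum fields in a finite volume. III. Renormalization*,
# Commun. Math. Phys. **88** (1983) 411–445 [Balaban1983Higgs3]: the displays (3.9), (3.11), (3.12) WITH BODIES, the estimates
# (3.13), (3.14) PROVED (pointwise and in the printed cube-localized form) and the summation step of (3.15) ON THE PRINT'S OWN CARRIER
# `ηℤ^{d+1}` — the lowest-order scalar self-energy graph minus its mass counterterm after Taylor's formula (3.10), under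
# (2.10)/(2.11)-type kernel hypotheses

statement-level skeleton of published theorems with citation tags; proofs where landed; nothing here is a claim about the Yang–Mills mass gap

PDF held: `paper:balaban1983-higgs-2-3-quantum-fields-finite-volume` (journal page = PDF page + 410); pp. 435–436 [PDF 25–26] read on the
×2 renders `run/shared/lean/pub/pub-balaban/b2b-balaban-ref1/pages/1983-cmp88-higgs23-III/1983-cmp88-higgs23-III-p025-x2.png`,
`…-p026-x2.png` (the text layer garbles the displays).

CITATION HEADER (lean-in-tree rule).  Part of the lit-balaban TYPED SKELETON (HOME `run/shared/lean/pub/lit-balaban/`), Phase 2: FILE B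
of p26 g34's three-file chain «(3.9)–(3.14) ON `ηℤ^{d+1}`» for SKELETON row **B3.Eq3.11-3.17** (fold owner r15).  Owner's head residual
(2026-08-22T23:10Z): *"every display (3.11)–(3.17) with a body and proved on the ηℤ^d carrier ((3.13)/(3.14) there rest on (2.6)/(2.10)
for G_k(0)'s pieces …) + the picture (3.17) at graph level"*; the print's §3 carrier is the infinite lattice (p. 433 *"with the scalar
field propagator equal to G_k(0)"* = `G_k(ηℤ^{d+1}, 0)`).  FILE A = `B3Taylor310Lattice` ((3.10) on `ℤ^{d+1}`: `pd`, `lin`, `rem`,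
`taylor310`, `norm_rem_le`, `norm_rem_le_of_leg`); FILE C = `B3Ineq314ZeroLattice` (the hypothesis-free instance for the (2.6)-pieces
of `G_k(0)`, from p26 g34 `B3Ineq210ZeroLattice`/`B3Ineq211ZeroLattice`).  THIS FILE is the `ℤ^{d+1}` twin of the TORUS files of
record of the row — r15's `B3Sect3ScalarSelfEnergy` ((3.9) `expr39`, (3.11) `eq311`, `dKernel`), p20 g2 `B3Ineq313Pointwise`
(`term312`, `abs_term312_le`), p20 g4 `B3Ineq314Local` (`abs_term312_le_local`), p20 g5 `B3Ineq314Cubes` (`abs_term312_le_cubes`,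
`abs_term312_le_local_cubes`) — same architecture and names with the suffix `Z`; p20's elementary lemmas (`exp_mul_weight_le`,
`exp_mul_weight_le_local`) and `supOn` are used BY NAME (imports), nothing of another seat is modified.

WHAT IS PRINTED (verbatim from the renders; `d` = the print's space-time dimension = this file's `d + 1`).
(3.9) p. 435: *"− Σ_{x,x′} η^{2d}φ(x)·[Σ_{μ=1}^d q(∂^η_μG_{(j)}(0)∂^{η*}_μ)(x,x′)qg(x)G_{(j′)}(x,x′)g′(x′)]φ′(x′)
+ Σ_{x,x′} η^{2d}φ(x)·[Σ_{μ=1}^d q(∂^η_μG_{(j)}(0)∂^{η*}_μ)(x,x′)qg(x)G_{(j′)}(x,x′)g′(x′)]φ′(x), (3.9) where g, g′ are localization functions."*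
(3.11) p. 436: *"(the expression (3.9)) = − Σ_{μ=1}^d Σ_x η^dφ(x)·[Σ_{x′}η^d Σ_{ν=1}^d q(∂^η_νG_{(j)}(0)∂^{η*}_ν)(x,x′)q·g(x)G_{(j′)}(x,x′)g′(x′)(x′_μ − x_μ)]
(∂^η_μφ′)(x) − Σ_{x,x′}η^{2d}φ(x)·[qΣ_{μ=1}^d(∂^η_μG_{(j)}(0)∂^{η*}_μ)(x,x′)qg(x)G_{(j′)}(x,x′)g′(x′)|x′ − x|^{1+α}]·Σ_{b⊂Γ_{x,x′}}
(η|b_− − x|^α/|x′ − x|^{1+α})((∂^ηφ′)(b) − (∂^ηφ′)((b)_x))/|b_− − x|^α. (3.11)"*; *"The second expression above already has the right form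
because the factor |x − x|^{1+α}"* ⟦sic; the print misprints `|x − x|` for `|x′ − x|`, cf. (3.10)/(3.11)⟧ *"adds to the degree of the graph
the number 1 + α … The operator acting on the leg φ′ is a differentiation of the order 1 + α, so we will represent graphically this
expression by the generalized graph [picture] (3.12)"*.
(3.13) p. 436: *"We localize additionally the vertices in cubes Δ(v), Δ(v′), |Δ(v)| = |Δ(v′)| = (L^{j₁}η)^d, j₁ = min{j, j′}, and we have
(the expression (3.12)) ≦ O(1) Σ_{Δ(v),Δ(v′)} sup_{x∈Δ(v)}|φ(x)|(L^{j₁}η)^{2d}(L^jη)^{−d}·e^{−δ₀(L^jη)^{−1}dist(Δ(v),Δ(v′))}(L^{j′}η)^{−d+2}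
e^{−δ₀(L^{j′}η)^{−1}dist(Δ(v),Δ(v′))}·((L^{j₁}η)^{−1}dist(Δ(v),Δ(v′)))^{1+α}·(L^{j₁}η)^{1+α} sup_{x∈Δ(v),x′∈Δ(v′)} sup_{y∈Γ_{x,x′},μ}
|(∂^η_μφ′)(y) − (∂^η_μφ′)(x)|/|y − x|^α. (3.13)"*
(3.14) p. 436: *"We can estimate the factor ((L^{j₁}η)^{−1}dist(Δ(v),Δ(v′)))^{1+α} by O(1) using half of the exponential factor with index j₁.
If φ′ is a leg of a propagator with an index j″, whose second leg is localized in Δ(v″), then the last supremum in (3.13) can be estimated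
by O(1)(L^{j″}η)^{−d+1−α} sup_{x∈Δ(v),x′∈Δ(v′)} exp[−δ₀(L^{j″}η)^{−1}dist(Γ_{x,x′},Δ(v″))], and the exponential factor together with another
exponential factor in (3.13) give us the estimate (the expression (3.12)) ≦ O(1) Σ_{Δ(v),Δ(v′)} sup_{x∈Δ(v)}|φ(x)|(L^{j₁}η)^{2d}(L^jη)^{−d}
·exp[−½δ₀(L^jη)^{−1}dist(Δ(v),Δ(v′))](L^{j′}η)^{−d+2}exp[−½δ₀(L^{j′}η)^{−1}dist(Δ(v),Δ(v′))]·(L^{j₁}η)^{1+α}(L^{j″}η)^{−d+1−α}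
exp[−½δ₀(L^{j″}η)^{−1}dist(Δ(v),Δ(v″))] (there may be an additional negative power of L^{j″}η coming from differentiations in the vertex
v″). (3.14)"*

DISPLAY ↦ THEOREM (the owner's audit table).
* (3.9)  ↦ `expr39Z` (def with body; bracket `coeff39Z`, kernel `dKernelZ` = `(∂^η_μG∂^{η*}_μ)(x,x′)`, PROVED to be the kernel of the
  composed operator on localized fields: `pd_kernelOpOn_pdAdj`); `expr39Z_eq_sub` (the two terms combine to `φ′(x′) − φ′(x)`).
* (3.11) ↦ `eq311Z` PROVED, hypothesis-free: `expr39Z = −term311Z − term312Z` (Taylor (3.10) = FILE A's `taylor310` inside the pairing).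
* (3.12) ↦ `term312Z` (def with body: the second term of (3.11), the generalized expression of degree `−d + 3 + α`).
* (3.13) ↦ `abs_term312Z_le` (pointwise in `x, x′`) and `abs_term312Z_le_cubes` (the printed cube-localized form `Σ_{Δ(v),Δ(v′)} sup …`).
* (3.14) ↦ `abs_term312Z_le_local` (pointwise) and `abs_term312Z_le_local_cubes` (printed form, third cube `Δ(v″)`).
* (3.15) p. 437 (the summation step *"we sum with respect to j, j′ from 0 to j″ … After the summations we get … G_{j″}(0) …"*) ↦
  `eq315Z_resum` (§2b: the first term `term311Z` is bilinear in the two propagators, so the double sum over the line indices is the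
  term with the summed propagators; FILE C's `eq315Z_zeroLattice` identifies the sums of the pieces with the resummed `G_n(0)`).
The kernel bounds ((2.10) for `G_{(j′)}`, the mixed-derivative (2.10) clause for `∂^η_μG_{(j)}(0)∂^{η*}_μ`, the (2.11)-shaped leg bound) are
HYPOTHESES here (`hGj`, `hGj'`, `hφ'`/`hleg`) — FILE C instantiates them for the pieces of `G_k(0)` on `ηℤ^{d+1}`.

WHAT IS REPRODUCED, and how (kind «displays with bodies + proved estimates»; every theorem proved).
* §1 kernels on `ℤ^{d+1}`: `KernelZ`, `dKernelZ c μ G`, `pdAdj`, `kernelOpOn T w K f` (operator with kernel `K`, volume element `w = η^{d+1}`,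
  summed over a finite set `T` — the fields of (3.9) are localized), `pd_kernelOpOn_pdAdj` (summation by parts on `ℤ^{d+1}`).
* §2 `coeff39Z`, `graphTerm39Z`, `counterTerm39Z`, `expr39Z` — the sums `Σ_{x,x′}` run over explicit finite localization sets `Λ ∋ x`,
  `Λ′ ∋ x′` (the supports of `g`, `g′`; for (3.13) the cubes); `term311Z`, `term312Z`, `eq311Z`.
* §2b linearity of `dKernelZ`/`coeff39Z`/`term311Z` in each propagator (`…_add_left/_right`, `…_sum_left/_right`) and the (3.15)
  summation identity **`eq315Z_resum`**: `Σ_{j∈S}Σ_{j′∈S′} term311Z(G_j, G′_{j′}) = term311Z(Σ_j G_j, Σ_{j′} G′_{j′})`.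
* §3 `abs_coeff39Z_le`; **`abs_term312Z_le`**: `|(3.12)| ≤ (d+1)C₁C₂Q²H(2/δ+8/δ²)·(m·m^α)·Σ_{x∈Λ,x′∈Λ′}η^{2(d+1)}‖φ(x)‖s^{−(d+1)}e^{−½δη|x−x′|₁/s}
  s′^{2−(d+1)}e^{−½δη|x−x′|₁/s′}`, `m = min(s,s′)` (the printed `(L^jη)^{−d}e^{…}(L^{j′}η)^{−d+2}e^{…}(L^{j₁}η)^{1+α}·[Hölder factor ≤ H]`, `δ₀ = ½δ`);
  **`abs_term312Z_le_local`**: the same with the extra factor `e^{−½δη|x−x″|₁/s″}` and `C₃` (for `O(1)(L^{j″}η)^{−d+1−α}`) in place of `H`,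
  for `max(s,s′) ≤ s″`, from the leg bound `hleg` through FILE A's `norm_rem_le_of_leg` (*"dist(Γ_{x,x′}, Δ(v″))"*).
* §4 cubes of `ℤ^{d+1}` of side `M` (`cubeIdxZ` = `⌊x_μ/M⌋`, `cubesZ`, `fiberZ`, `card_fiberZ_le : #(Λ ∩ Δ) ≤ M^{d+1}`, `cdistZ` = `dist(Δ,Δ′)`
  in lattice steps, `sum_sum_le_cubesZ` = the localization step `Σ_{x,x′}η^{2(d+1)} f(x)w(x,x′) ≤ Σ_{Δ,Δ′}(Mη)^{2(d+1)} sup_Δ f · W(Δ,Δ′)`).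
* §5 **`abs_term312Z_le_cubes`** ((3.13) as displayed, every cube side `M ≥ 1`; the print `M = L^{j₁}`) and **`abs_term312Z_le_local_cubes`**
  ((3.14) as displayed, cubes of sides `M` and `M″`).

HONEST SCOPE / DECLARED DIVERGENCES (F7).  (i) ZERO BACKGROUND (`∂^η`, no parallel transport; the §3 setting p. 433), scalar fields with
values in a real inner-product space `W` (print: `ℝ^N`), charge matrix `q : W →ₗ W` with `‖qw‖ ≤ Q‖w‖`; internal-index structure of the
free propagators = identity (as in the torus files).  (ii) `|x − x′|` = the `ℓ¹` lattice distance `η·dist₁` (print: unspecified norm;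
`Setup` divergence F2 of the torus files); `dist(Δ,Δ′)` = least `ℓ¹` distance.  (iii) The sums of (3.9) are carried over explicit finite
localization sets `Λ, Λ′` (the print's `Σ_{x,x′}` with localization functions `g, g′` of bounded support; `|g|,|g′| ≤ 1` are hypotheses).
(iv) (3.13): the Hölder supremum is bounded by a GLOBAL Hölder constant `H` (≥ the printed local supremum); the middle factor
`((L^{j₁}η)^{−1}dist(Δ(v),Δ(v′)))^{1+α}` (GAPS G-B3-07, a located slip: it is ≤ O(1) only after spending half an exponential, which the
print does in the next sentence) is not reproduced — the theorem is the print's bound AFTER that step (`δ₀ = ½δ`).  (v) Constants explicit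
and dimension `d + 1 ≥ 1`; cube sides arbitrary `M ≥ 1`.  (vi) The kernel estimates are hypotheses (rows B3.Eq2.10/2.11; instances: p03's box/
torus lineage, p26 g34's lattice files; FILE C).  Theorems and definitions with bodies only; no Literature fact minted, no `sorry`; standard
axioms.  Value = (3.9)/(3.11)–(3.14) on the printed carrier, NOT summit progress.
Unit `lit-balaban-p26` (Phase-2 proof seat p26, gen 34); HOME `run/shared/lean/pub/lit-balaban/` (row B3.Eq3.11-3.17, FILED.md, STATUS.md),
2026-08-23.
-/

open scoped BigOperators RealInnerProductSpace

namespace Literature.MathematicalPhysics.QuantumFieldTheory.Balaban1983to89.B3Ineq313Lattice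

open B3Taylor310Lattice B3Ineq313Pointwise B3Ineq314Local
open B3Ineq314Cubes (supOn le_supOn supOn_le supOn_nonneg)

noncomputable section

variable {d : ℕ}

/-! ## §1 Two-point kernels on `ηℤ^{d+1}` and the kernel of `∂^η_μ G ∂^{η*}_μ` -/

section Kernels

/-- Two-point kernels `G(x, x′)` on the lattice `ηℤ^{d+1}` (sites `ℤ^{d+1}`; the propagators `G_{(j)}(0)`, `G_{(j′)}` of (3.9) on the
print's §3 carrier, p. 433). [cite: Balaban1983Higgs3, (3.9) p.435] -/
abbrev KernelZ (d : ℕ) : Type := (Fin (d + 1) → ℤ) → (Fin (d + 1) → ℤ) → ℝ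

/-- **The kernel `(∂^η_μ G ∂^{η*}_μ)(x, x′)`** of (3.9) on `ηℤ^{d+1}`: the mixed second difference quotient
`c²(G(x+e_μ, x′+e_μ) − G(x+e_μ, x′) − G(x, x′+e_μ) + G(x, x′))`, `c = η⁻¹` (the `ℤ^{d+1}` twin of `B3Sect3ScalarSelfEnergy.dKernel`;
that it is the kernel of the composed operator is `pd_kernelOpOn_pdAdj`). [cite: Balaban1983Higgs3, (3.9) p.435] -/
def dKernelZ (c : ℝ) (μ : Fin (d + 1)) (G : KernelZ d) : KernelZ d :=
  fun x x' => c ^ 2 * (G (x + Pi.single μ 1) (x' + Pi.single μ 1) - G (x + Pi.single μ 1) x' - G x (x' + Pi.single μ 1) + G x x')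

/-- The backward derivative `(∂^{η*}_μ f)(x) = η⁻¹(f(x − ηe_μ) − f(x))` — the adjoint of `∂^η_μ` for `Σ_x η^{d+1}` (zero background).
[cite: Balaban1983Higgs3, (3.9) p.435] -/
def pdAdj (c : ℝ) (μ : Fin (d + 1)) (f : (Fin (d + 1) → ℤ) → ℝ) (x : Fin (d + 1) → ℤ) : ℝ :=
  c * (f (x - Pi.single μ 1) - f x)

/-- The operator with kernel `K` and volume element `w = η^{d+1}` applied to a field summed over the finite set `T`:
`(Kf)(y) = Σ_{x′∈T} w·K(y,x′)f(x′)` (on `ηℤ^{d+1}` the fields of (3.9) are localized, so all sums are finite).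
[cite: Balaban1983Higgs3, (3.9) p.435] -/
def kernelOpOn (T : Finset (Fin (d + 1) → ℤ)) (w : ℝ) (K : KernelZ d) (f : (Fin (d + 1) → ℤ) → ℝ)
    (y : Fin (d + 1) → ℤ) : ℝ :=
  ∑ x' ∈ T, w * K y x' * f x'

/-- kernel: a sum of a field vanishing off `S` over any finite `T ⊇ S` is its sum over `S`. [folklore] -/
private theorem sum_eq_sum_of_vanish {S T : Finset (Fin (d + 1) → ℤ)} (hST : S ⊆ T) {F f : (Fin (d + 1) → ℤ) → ℝ}
    (hf : ∀ x ∉ S, f x = 0) : ∑ x ∈ T, F x * f x = ∑ x ∈ S, F x * f x := by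
  rw [← Finset.sum_subset hST]
  intro x _ hxS
  rw [hf x hxS, mul_zero]

/-- **`dKernelZ` is the kernel of `∂^η_μ ∘ G ∘ ∂^{η*}_μ`**: for a field `f` vanishing off a finite set `S` and any finite `T`
containing `S` and `S + e_μ` (so that `T` carries `f` and `∂^{η*}_μ f`), `∂^η_μ(y ↦ Σ_{x′∈T} wG(y,x′)(∂^{η*}_μf)(x′)) =
Σ_{x′∈T} w·(∂^η_μG∂^{η*}_μ)(y,x′)f(x′)` (summation by parts; the `ℤ^{d+1}` twin of `B3Sect3ScalarSelfEnergy.kernelOp_dKernel`).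
[cite: Balaban1983Higgs3, (3.9) p.435] -/
theorem pd_kernelOpOn_pdAdj {S T : Finset (Fin (d + 1) → ℤ)} (hST : S ⊆ T) (μ : Fin (d + 1))
    (hSe : ∀ x ∈ S, x + Pi.single μ 1 ∈ T) (w c : ℝ) (K : KernelZ d) {f : (Fin (d + 1) → ℤ) → ℝ}
    (hf : ∀ x ∉ S, f x = 0) (y : Fin (d + 1) → ℤ) :
    pd c μ (kernelOpOn T w K (pdAdj c μ f)) y = kernelOpOn T w (dKernelZ c μ K) f y := by
  -- the operator applied to `∂^{η*}_μ f`, resolved into the two shifted sums over `S`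
  have hop : ∀ z : Fin (d + 1) → ℤ, kernelOpOn T w K (pdAdj c μ f) z =
      ∑ x ∈ S, w * c * (K z (x + Pi.single μ 1) - K z x) * f x := by
    intro z
    unfold kernelOpOn pdAdj
    have h1 : ∑ x' ∈ T, w * K z x' * (c * (f (x' - Pi.single μ 1) - f x')) =
        (∑ x' ∈ T, (w * c * K z x') * f (x' - Pi.single μ 1)) - ∑ x' ∈ T, (w * c * K z x') * f x' := by
      rw [← Finset.sum_sub_distrib]; exact Finset.sum_congr rfl fun x' _ => by ring
    -- the shifted sum: substitute `x' = x + e_μ`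
    have h2 : ∑ x' ∈ T, (w * c * K z x') * f (x' - Pi.single μ 1) =
        ∑ x ∈ S, (w * c * K z (x + Pi.single μ 1)) * f x := by
      have hinj : Set.InjOn (fun x : Fin (d + 1) → ℤ => x - Pi.single μ 1) ↑T := fun a _ b _ h => sub_left_injective h
      have step : ∑ x' ∈ T, (w * c * K z x') * f (x' - Pi.single μ 1) =
          ∑ x ∈ T.image (fun x' => x' - Pi.single μ 1), (w * c * K z (x + Pi.single μ 1)) * f x := by
        rw [Finset.sum_image hinj]
        exact Finset.sum_congr rfl fun x' _ => by rw [sub_add_cancel]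
      rw [step]
      refine sum_eq_sum_of_vanish (fun x hx => ?_) hf
      exact Finset.mem_image.2 ⟨x + Pi.single μ 1, hSe x hx, add_sub_cancel_right _ _⟩
    rw [h1, h2, sum_eq_sum_of_vanish hST hf, ← Finset.sum_sub_distrib]
    exact Finset.sum_congr rfl fun x _ => by ring
  unfold pd
  rw [hop, hop, smul_eq_mul, ← Finset.sum_sub_distrib, Finset.mul_sum, kernelOpOn, sum_eq_sum_of_vanish hST hf]
  refine Finset.sum_congr rfl fun x _ => ?_
  simp only [dKernelZ]
  ring

end Kernels

/-! ## §2 (3.9), (3.11) and (3.12) on `ηℤ^{d+1}` with finite localization sets -/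

section Eq311

variable {W : Type*} [NormedAddCommGroup W] [InnerProductSpace ℝ W]

/-- The bracket of **(3.9)** without the charge matrices: `c(x,x′) = Σ_μ(∂^η_μG_{(j)}(0)∂^{η*}_μ)(x,x′)·g(x)G_{(j′)}(x,x′)g′(x′)` on
`ηℤ^{d+1}` (twin of `B3Sect3ScalarSelfEnergy.coeff39`). [cite: Balaban1983Higgs3, (3.9) p.435] -/
def coeff39Z (η : ℝ) (Gj Gj' : KernelZ d) (g g' : (Fin (d + 1) → ℤ) → ℝ) : KernelZ d :=
  fun x x' => (∑ μ : Fin (d + 1), dKernelZ η⁻¹ μ Gj x x') * g x * Gj' x x' * g' x'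

/-- The first (graph) term of **(3.9)** without its sign, `Σ_{x,x′} η^{2d}φ(x)·[q c(x,x′) q]φ′(x′)`, the sums running over finite
localization sets `Λ ∋ x`, `Λ′ ∋ x′` (on `ηℤ^{d+1}` the localization functions `g`, `g′` have finite supports; for (3.13) the cubes
`Δ(v)`, `Δ(v′)`). [cite: Balaban1983Higgs3, (3.9) p.435] -/
def graphTerm39Z (η : ℝ) (q : W →ₗ[ℝ] W) (Gj Gj' : KernelZ d) (g g' : (Fin (d + 1) → ℤ) → ℝ)
    (φ φ' : (Fin (d + 1) → ℤ) → W) (Λ Λ' : Finset (Fin (d + 1) → ℤ)) : ℝ :=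
  ∑ x ∈ Λ, ∑ x' ∈ Λ', η ^ (2 * (d + 1)) * (coeff39Z η Gj Gj' g g' x x' * ⟪φ x, q (q (φ' x'))⟫)

/-- The second (mass counterterm) term of **(3.9)**: the same with `φ′(x)` in place of `φ′(x′)`. [cite: Balaban1983Higgs3, (3.9) p.435] -/
def counterTerm39Z (η : ℝ) (q : W →ₗ[ℝ] W) (Gj Gj' : KernelZ d) (g g' : (Fin (d + 1) → ℤ) → ℝ)
    (φ φ' : (Fin (d + 1) → ℤ) → W) (Λ Λ' : Finset (Fin (d + 1) → ℤ)) : ℝ :=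
  ∑ x ∈ Λ, ∑ x' ∈ Λ', η ^ (2 * (d + 1)) * (coeff39Z η Gj Gj' g g' x x' * ⟪φ x, q (q (φ' x))⟫)

/-- **(3.9)** p. 435 [PDF 25] on `ηℤ^{d+1}`: `−Σ_{x,x′}η^{2d}φ(x)·[Σ_μ q(∂^η_μG_{(j)}(0)∂^{η*}_μ)(x,x′)q g(x)G_{(j′)}(x,x′)g′(x′)]φ′(x′)
+ Σ_{x,x′}η^{2d}φ(x)·[…]φ′(x)` (twin of `B3Sect3ScalarSelfEnergy.expr39`). [cite: Balaban1983Higgs3, (3.9) p.435] -/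
def expr39Z (η : ℝ) (q : W →ₗ[ℝ] W) (Gj Gj' : KernelZ d) (g g' : (Fin (d + 1) → ℤ) → ℝ)
    (φ φ' : (Fin (d + 1) → ℤ) → W) (Λ Λ' : Finset (Fin (d + 1) → ℤ)) : ℝ :=
  -graphTerm39Z η q Gj Gj' g g' φ φ' Λ Λ' + counterTerm39Z η q Gj Gj' g g' φ φ' Λ Λ'

/-- the two terms of (3.9) combine to `−Σ_{x,x′}η^{2d}c(x,x′)φ(x)·q²(φ′(x′) − φ′(x))` — the form to which Taylor's formula (3.10) is
applied (*"We apply it to a leg φ′"*). [cite: Balaban1983Higgs3, (3.9) p.435] -/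
theorem expr39Z_eq_sub (η : ℝ) (q : W →ₗ[ℝ] W) (Gj Gj' : KernelZ d) (g g' : (Fin (d + 1) → ℤ) → ℝ)
    (φ φ' : (Fin (d + 1) → ℤ) → W) (Λ Λ' : Finset (Fin (d + 1) → ℤ)) :
    expr39Z η q Gj Gj' g g' φ φ' Λ Λ' =
      -∑ x ∈ Λ, ∑ x' ∈ Λ', η ^ (2 * (d + 1)) * (coeff39Z η Gj Gj' g g' x x' * ⟪φ x, q (q (φ' x' - φ' x))⟫) := by
  simp only [expr39Z, graphTerm39Z, counterTerm39Z, map_sub, inner_sub_right, mul_sub, Finset.sum_sub_distrib]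
  ring

/-- **The first term of (3.11)** p. 436 [PDF 26] without its sign — the local vertex with one derivative:
`Σ_μ Σ_x η^dφ(x)·[Σ_{x′}η^d Σ_ν q(∂^η_νG_{(j)}(0)∂^{η*}_ν)(x,x′)q·g(x)G_{(j′)}(x,x′)g′(x′)(x′_μ − x_μ)](∂^η_μφ′)(x)` (`x′_μ − x_μ = η·(x′_μ − x_μ)`
in lattice units). [cite: Balaban1983Higgs3, (3.11) p.436] -/
def term311Z (η : ℝ) (q : W →ₗ[ℝ] W) (Gj Gj' : KernelZ d) (g g' : (Fin (d + 1) → ℤ) → ℝ)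
    (φ φ' : (Fin (d + 1) → ℤ) → W) (Λ Λ' : Finset (Fin (d + 1) → ℤ)) : ℝ :=
  ∑ μ : Fin (d + 1), ∑ x ∈ Λ, η ^ (d + 1) *
    ((∑ x' ∈ Λ', η ^ (d + 1) * (coeff39Z η Gj Gj' g g' x x' * (η * ((x' μ - x μ : ℤ) : ℝ)))) *
      ⟪φ x, q (q (pd η⁻¹ μ φ' x))⟫)

/-- **(3.12)** p. 436 [PDF 26] — the second term of (3.11) without its sign, the generalized expression of degree `−d + 3 + α`:
`Σ_{x,x′}η^{2d}φ(x)·[qΣ_μ(∂^η_μG_{(j)}(0)∂^{η*}_μ)(x,x′)q g(x)G_{(j′)}(x,x′)g′(x′)]·(remainder of (3.10) along Γ_{x,x′} applied to φ′)`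
(the print inserts and divides `|x′ − x|^{1+α}`; twin of `B3Ineq313Pointwise.term312` with the `ℤ^{d+1}` remainder
`B3Taylor310Lattice.rem`). [cite: Balaban1983Higgs3, (3.12) p.436] -/
def term312Z (η : ℝ) (q : W →ₗ[ℝ] W) (Gj Gj' : KernelZ d) (g g' : (Fin (d + 1) → ℤ) → ℝ)
    (φ φ' : (Fin (d + 1) → ℤ) → W) (Λ Λ' : Finset (Fin (d + 1) → ℤ)) : ℝ :=
  ∑ x ∈ Λ, ∑ x' ∈ Λ', η ^ (2 * (d + 1)) * (coeff39Z η Gj Gj' g g' x x' * ⟪φ x, q (q (rem η⁻¹ φ' x x'))⟫)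

/-- **(3.11)** p. 436 [PDF 26] on `ηℤ^{d+1}`, PROVED with no hypothesis: `(the expression (3.9)) = −(first term) − (3.12)`, by
Taylor's formula (3.10) (`B3Taylor310Lattice.taylor310`) applied to the leg `φ′` inside the pairing and the exchange of the finite
sums. [cite: Balaban1983Higgs3, (3.11) p.436] -/
theorem eq311Z (η : ℝ) (q : W →ₗ[ℝ] W) (Gj Gj' : KernelZ d) (g g' : (Fin (d + 1) → ℤ) → ℝ)
    (φ φ' : (Fin (d + 1) → ℤ) → W) (Λ Λ' : Finset (Fin (d + 1) → ℤ)) :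
    expr39Z η q Gj Gj' g g' φ φ' Λ Λ' = -term311Z η q Gj Gj' g g' φ φ' Λ Λ' - term312Z η q Gj Gj' g g' φ φ' Λ Λ' := by
  rw [expr39Z_eq_sub, ← neg_add', term311Z, term312Z]
  congr 1
  have h2d : η ^ (2 * (d + 1)) = η ^ (d + 1) * η ^ (d + 1) := by rw [two_mul, pow_add]
  -- Taylor's formula (3.10) for the leg `φ′`, forward-derivative reading, `η⁻¹⁻¹ = η`
  have hT : ∀ x x' : Fin (d + 1) → ℤ, φ' x' - φ' x =
      (∑ μ : Fin (d + 1), (η * ((x' μ - x μ : ℤ) : ℝ)) • pd η⁻¹ μ φ' x) + rem η⁻¹ φ' x x' := by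
    intro x x'
    have h := taylor310 η⁻¹ φ' x x'
    simp only [lin, inv_inv] at h
    rw [h]; abel
  have hterm : ∀ x x' : Fin (d + 1) → ℤ, ⟪φ x, q (q (φ' x' - φ' x))⟫ =
      (∑ μ : Fin (d + 1), (η * ((x' μ - x μ : ℤ) : ℝ)) * ⟪φ x, q (q (pd η⁻¹ μ φ' x))⟫) + ⟪φ x, q (q (rem η⁻¹ φ' x x'))⟫ := by
    intro x x'
    rw [hT x x', map_add, map_add, inner_add_right, map_sum, map_sum, inner_sum]
    congr 1
    refine Finset.sum_congr rfl fun μ _ => ?_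
    rw [map_smul, map_smul, real_inner_smul_right]
  have hsplit : ∀ x x' : Fin (d + 1) → ℤ,
      η ^ (2 * (d + 1)) * (coeff39Z η Gj Gj' g g' x x' * ⟪φ x, q (q (φ' x' - φ' x))⟫) =
        (∑ μ : Fin (d + 1), η ^ (d + 1) *
            (η ^ (d + 1) * (coeff39Z η Gj Gj' g g' x x' * (η * ((x' μ - x μ : ℤ) : ℝ))) * ⟪φ x, q (q (pd η⁻¹ μ φ' x))⟫)) +
          η ^ (2 * (d + 1)) * (coeff39Z η Gj Gj' g g' x x' * ⟪φ x, q (q (rem η⁻¹ φ' x x'))⟫) := by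
    intro x x'
    rw [hterm, mul_add (coeff39Z η Gj Gj' g g' x x'), mul_add (η ^ (2 * (d + 1))), Finset.mul_sum, Finset.mul_sum, h2d]
    congr 1
    exact Finset.sum_congr rfl fun μ _ => by ring
  simp_rw [hsplit, Finset.sum_add_distrib]
  congr 1
  calc ∑ x ∈ Λ, ∑ x' ∈ Λ', ∑ μ : Fin (d + 1), η ^ (d + 1) *
          (η ^ (d + 1) * (coeff39Z η Gj Gj' g g' x x' * (η * ((x' μ - x μ : ℤ) : ℝ))) * ⟪φ x, q (q (pd η⁻¹ μ φ' x))⟫)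
      = ∑ x ∈ Λ, ∑ μ : Fin (d + 1), ∑ x' ∈ Λ', η ^ (d + 1) *
          (η ^ (d + 1) * (coeff39Z η Gj Gj' g g' x x' * (η * ((x' μ - x μ : ℤ) : ℝ))) * ⟪φ x, q (q (pd η⁻¹ μ φ' x))⟫) :=
        Finset.sum_congr rfl fun x _ => Finset.sum_comm
    _ = ∑ μ : Fin (d + 1), ∑ x ∈ Λ, ∑ x' ∈ Λ', η ^ (d + 1) *
          (η ^ (d + 1) * (coeff39Z η Gj Gj' g g' x x' * (η * ((x' μ - x μ : ℤ) : ℝ))) * ⟪φ x, q (q (pd η⁻¹ μ φ' x))⟫) :=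
        Finset.sum_comm
    _ = ∑ μ : Fin (d + 1), ∑ x ∈ Λ, η ^ (d + 1) *
          ((∑ x' ∈ Λ', η ^ (d + 1) * (coeff39Z η Gj Gj' g g' x x' * (η * ((x' μ - x μ : ℤ) : ℝ)))) *
            ⟪φ x, q (q (pd η⁻¹ μ φ' x))⟫) := by
        refine Finset.sum_congr rfl fun μ _ => Finset.sum_congr rfl fun x _ => ?_
        rw [Finset.sum_mul, Finset.mul_sum]

end Eq311

/-! ## §2b (3.15) p. 437: the summation of the first term over the indices of the internal lines -/

section Resum

variable {W : Type*} [NormedAddCommGroup W] [InnerProductSpace ℝ W]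

/-- the kernel `(∂^η_μ G ∂^{η*}_μ)(x,x′)` is additive in the propagator `G`. [cite: Balaban1983Higgs3, (3.15) p.437] -/
theorem dKernelZ_add (c : ℝ) (μ : Fin (d + 1)) (K M : KernelZ d) (x x' : Fin (d + 1) → ℤ) :
    dKernelZ c μ (K + M) x x' = dKernelZ c μ K x x' + dKernelZ c μ M x x' := by
  simp only [dKernelZ, Pi.add_apply]; ring

/-- the kernel of the zero propagator vanishes. [cite: Balaban1983Higgs3, (3.15) p.437] -/
theorem dKernelZ_zero (c : ℝ) (μ : Fin (d + 1)) (x x' : Fin (d + 1) → ℤ) : dKernelZ c μ (0 : KernelZ d) x x' = 0 := by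
  simp [dKernelZ]

/-- the bracket of (3.9) is additive in the differentiated propagator. [cite: Balaban1983Higgs3, (3.15) p.437] -/
theorem coeff39Z_add_left (η : ℝ) (K M Gj' : KernelZ d) (g g' : (Fin (d + 1) → ℤ) → ℝ) (x x' : Fin (d + 1) → ℤ) :
    coeff39Z η (K + M) Gj' g g' x x' = coeff39Z η K Gj' g g' x x' + coeff39Z η M Gj' g g' x x' := by
  simp only [coeff39Z, dKernelZ_add, Finset.sum_add_distrib]; ring

/-- the bracket of (3.9) is additive in the undifferentiated propagator. [cite: Balaban1983Higgs3, (3.15) p.437] -/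
theorem coeff39Z_add_right (η : ℝ) (Gj K M : KernelZ d) (g g' : (Fin (d + 1) → ℤ) → ℝ) (x x' : Fin (d + 1) → ℤ) :
    coeff39Z η Gj (K + M) g g' x x' = coeff39Z η Gj K g g' x x' + coeff39Z η Gj M g g' x x' := by
  simp only [coeff39Z, Pi.add_apply]; ring

/-- the bracket of (3.9) vanishes for the zero differentiated propagator. [cite: Balaban1983Higgs3, (3.15) p.437] -/
theorem coeff39Z_zero_left (η : ℝ) (Gj' : KernelZ d) (g g' : (Fin (d + 1) → ℤ) → ℝ) (x x' : Fin (d + 1) → ℤ) :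
    coeff39Z η 0 Gj' g g' x x' = 0 := by
  simp [coeff39Z, dKernelZ_zero]

/-- the bracket of (3.9) vanishes for the zero undifferentiated propagator. [cite: Balaban1983Higgs3, (3.15) p.437] -/
theorem coeff39Z_zero_right (η : ℝ) (Gj : KernelZ d) (g g' : (Fin (d + 1) → ℤ) → ℝ) (x x' : Fin (d + 1) → ℤ) :
    coeff39Z η Gj 0 g g' x x' = 0 := by
  simp [coeff39Z]

/-- the first term of (3.11) is additive in the differentiated propagator. [cite: Balaban1983Higgs3, (3.15) p.437] -/
theorem term311Z_add_left (η : ℝ) (q : W →ₗ[ℝ] W) (K M Gj' : KernelZ d) (g g' : (Fin (d + 1) → ℤ) → ℝ)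
    (φ φ' : (Fin (d + 1) → ℤ) → W) (Λ Λ' : Finset (Fin (d + 1) → ℤ)) :
    term311Z η q (K + M) Gj' g g' φ φ' Λ Λ' = term311Z η q K Gj' g g' φ φ' Λ Λ' + term311Z η q M Gj' g g' φ φ' Λ Λ' := by
  simp only [term311Z, coeff39Z_add_left, add_mul, mul_add, Finset.sum_add_distrib]

/-- the first term of (3.11) is additive in the undifferentiated propagator. [cite: Balaban1983Higgs3, (3.15) p.437] -/
theorem term311Z_add_right (η : ℝ) (q : W →ₗ[ℝ] W) (Gj K M : KernelZ d) (g g' : (Fin (d + 1) → ℤ) → ℝ)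
    (φ φ' : (Fin (d + 1) → ℤ) → W) (Λ Λ' : Finset (Fin (d + 1) → ℤ)) :
    term311Z η q Gj (K + M) g g' φ φ' Λ Λ' = term311Z η q Gj K g g' φ φ' Λ Λ' + term311Z η q Gj M g g' φ φ' Λ Λ' := by
  simp only [term311Z, coeff39Z_add_right, add_mul, mul_add, Finset.sum_add_distrib]

/-- no differentiated propagator, no first term. [cite: Balaban1983Higgs3, (3.15) p.437] -/
theorem term311Z_zero_left (η : ℝ) (q : W →ₗ[ℝ] W) (Gj' : KernelZ d) (g g' : (Fin (d + 1) → ℤ) → ℝ)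
    (φ φ' : (Fin (d + 1) → ℤ) → W) (Λ Λ' : Finset (Fin (d + 1) → ℤ)) :
    term311Z η q 0 Gj' g g' φ φ' Λ Λ' = 0 := by
  simp [term311Z, coeff39Z_zero_left]

/-- no undifferentiated propagator, no first term. [cite: Balaban1983Higgs3, (3.15) p.437] -/
theorem term311Z_zero_right (η : ℝ) (q : W →ₗ[ℝ] W) (Gj : KernelZ d) (g g' : (Fin (d + 1) → ℤ) → ℝ)
    (φ φ' : (Fin (d + 1) → ℤ) → W) (Λ Λ' : Finset (Fin (d + 1) → ℤ)) :
    term311Z η q Gj 0 g g' φ φ' Λ Λ' = 0 := by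
  simp [term311Z, coeff39Z_zero_right]

/-- the first term of (3.11) commutes with finite sums of differentiated propagators. [cite: Balaban1983Higgs3, (3.15) p.437] -/
theorem term311Z_sum_left {ι : Type*} (S : Finset ι) (G : ι → KernelZ d) (η : ℝ) (q : W →ₗ[ℝ] W) (Gj' : KernelZ d)
    (g g' : (Fin (d + 1) → ℤ) → ℝ) (φ φ' : (Fin (d + 1) → ℤ) → W) (Λ Λ' : Finset (Fin (d + 1) → ℤ)) :
    term311Z η q (∑ j ∈ S, G j) Gj' g g' φ φ' Λ Λ' = ∑ j ∈ S, term311Z η q (G j) Gj' g g' φ φ' Λ Λ' := by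
  classical
  refine Finset.induction_on S ?_ ?_
  · simp [term311Z_zero_left]
  · intro j S hj ih
    rw [Finset.sum_insert hj, Finset.sum_insert hj, term311Z_add_left, ih]

/-- the first term of (3.11) commutes with finite sums of undifferentiated propagators. [cite: Balaban1983Higgs3, (3.15) p.437] -/
theorem term311Z_sum_right {ι : Type*} (S : Finset ι) (G : ι → KernelZ d) (η : ℝ) (q : W →ₗ[ℝ] W) (Gj : KernelZ d)
    (g g' : (Fin (d + 1) → ℤ) → ℝ) (φ φ' : (Fin (d + 1) → ℤ) → W) (Λ Λ' : Finset (Fin (d + 1) → ℤ)) :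
    term311Z η q Gj (∑ j ∈ S, G j) g g' φ φ' Λ Λ' = ∑ j ∈ S, term311Z η q Gj (G j) g g' φ φ' Λ Λ' := by
  classical
  refine Finset.induction_on S ?_ ?_
  · simp [term311Z_zero_right]
  · intro j S hj ih
    rw [Finset.sum_insert hj, Finset.sum_insert hj, term311Z_add_right, ih]

/-- **(3.15)** p. 437 [PDF 27], the summation step, PROVED on `ηℤ^{d+1}`: *"Let us consider the first expression on the right side of
(3.11). The same expression appears for all orderings of the lines of the graph G₀ with the only condition that they are earlier than the
external lines. Making summations over these orderings and indices means that we sum with respect to j, j′ from 0 to j″, where j″ is the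
lowest index of the external lines. After the summations we get − Σ_μ Σ_x η^dφ(x)·[Σ_{x′}η^d Σ_ν q(∂^η_νG_{j″}(0)∂^{η*}_ν)(x,x′)q g(x)
G_{j″}(x,x′)g′(x′)(x′_μ − x_μ)](∂^η_μφ′)(x), (3.15)"* — the first term is bilinear in the two propagators, so the double sum over the
indices of the internal lines is the same term with both propagators replaced by their sums (for the pieces of `G_k(0)` the sums are the
resummed propagators, `B3Ineq314ZeroLattice.eq315Z_zeroLattice`). [cite: Balaban1983Higgs3, (3.15) p.437] -/
theorem eq315Z_resum {ι ι' : Type*} (S : Finset ι) (S' : Finset ι') (G : ι → KernelZ d) (G' : ι' → KernelZ d) (η : ℝ)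
    (q : W →ₗ[ℝ] W) (g g' : (Fin (d + 1) → ℤ) → ℝ) (φ φ' : (Fin (d + 1) → ℤ) → W) (Λ Λ' : Finset (Fin (d + 1) → ℤ)) :
    ∑ j ∈ S, ∑ j' ∈ S', term311Z η q (G j) (G' j') g g' φ φ' Λ Λ' =
      term311Z η q (∑ j ∈ S, G j) (∑ j' ∈ S', G' j') g g' φ φ' Λ Λ' := by
  rw [term311Z_sum_left]
  exact Finset.sum_congr rfl fun j _ => (term311Z_sum_right S' G' η q (G j) g g' φ φ' Λ Λ').symm

end Resum


/-! ## §3 (3.13)/(3.14) pointwise: the degree count behind the picture (3.12) -/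

section Pointwise

variable {W : Type*} [NormedAddCommGroup W] [InnerProductSpace ℝ W]

/-- kernel: the bracket of (3.9) under the (2.10)-type kernel bounds on `ηℤ^{d+1}`: `|c(x,x′)| ≤ (d+1)C₁s^{−(d+1)}e^{−δu/s}·C₂s′^{2−(d+1)}e^{−δu/s′}`,
`u = η|x − x′|₁`, `|g|, |g′| ≤ 1` (twin of `B3Ineq313Pointwise.abs_coeff39_le`). [cite: Balaban1983Higgs3, (3.13) p.436] -/
theorem abs_coeff39Z_le {η C₁ C₂ δ s s' : ℝ} {Gj Gj' : KernelZ d} {g g' : (Fin (d + 1) → ℤ) → ℝ}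
    (hg : ∀ x, |g x| ≤ 1) (hg' : ∀ x, |g' x| ≤ 1)
    (hGj : ∀ (μ : Fin (d + 1)) (x x' : Fin (d + 1) → ℤ),
      |dKernelZ η⁻¹ μ Gj x x'| ≤ C₁ * s ^ (-((d + 1 : ℕ) : ℝ)) * Real.exp (-(δ * s⁻¹ * (η * dist₁ x x'))))
    (hGj' : ∀ x x' : Fin (d + 1) → ℤ,
      |Gj' x x'| ≤ C₂ * s' ^ (2 - ((d + 1 : ℕ) : ℝ)) * Real.exp (-(δ * s'⁻¹ * (η * dist₁ x x'))))
    (x x' : Fin (d + 1) → ℤ) :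
    |coeff39Z η Gj Gj' g g' x x'| ≤
      (((d + 1 : ℕ) : ℝ) * (C₁ * s ^ (-((d + 1 : ℕ) : ℝ)) * Real.exp (-(δ * s⁻¹ * (η * dist₁ x x'))))) *
        (C₂ * s' ^ (2 - ((d + 1 : ℕ) : ℝ)) * Real.exp (-(δ * s'⁻¹ * (η * dist₁ x x')))) := by
  have hsum : |∑ μ : Fin (d + 1), dKernelZ η⁻¹ μ Gj x x'|
      ≤ ((d + 1 : ℕ) : ℝ) * (C₁ * s ^ (-((d + 1 : ℕ) : ℝ)) * Real.exp (-(δ * s⁻¹ * (η * dist₁ x x')))) := by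
    calc |∑ μ : Fin (d + 1), dKernelZ η⁻¹ μ Gj x x'| ≤ ∑ μ : Fin (d + 1), |dKernelZ η⁻¹ μ Gj x x'| :=
          Finset.abs_sum_le_sum_abs _ _
      _ ≤ ∑ _μ : Fin (d + 1), C₁ * s ^ (-((d + 1 : ℕ) : ℝ)) * Real.exp (-(δ * s⁻¹ * (η * dist₁ x x'))) :=
          Finset.sum_le_sum fun μ _ => hGj μ x x'
      _ = ((d + 1 : ℕ) : ℝ) * (C₁ * s ^ (-((d + 1 : ℕ) : ℝ)) * Real.exp (-(δ * s⁻¹ * (η * dist₁ x x')))) := by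
          rw [Finset.sum_const, Finset.card_univ, Fintype.card_fin, nsmul_eq_mul]
  have hA : 0 ≤ ((d + 1 : ℕ) : ℝ) * (C₁ * s ^ (-((d + 1 : ℕ) : ℝ)) * Real.exp (-(δ * s⁻¹ * (η * dist₁ x x')))) :=
    (abs_nonneg _).trans hsum
  have hB : 0 ≤ C₂ * s' ^ (2 - ((d + 1 : ℕ) : ℝ)) * Real.exp (-(δ * s'⁻¹ * (η * dist₁ x x'))) :=
    (abs_nonneg _).trans (hGj' x x')
  have h1 := hg x
  have h2 := hGj' x x'
  have h3 := hg' x'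
  unfold coeff39Z
  rw [abs_mul, abs_mul, abs_mul]
  calc |∑ μ : Fin (d + 1), dKernelZ η⁻¹ μ Gj x x'| * |g x| * |Gj' x x'| * |g' x'|
      ≤ (((d + 1 : ℕ) : ℝ) * (C₁ * s ^ (-((d + 1 : ℕ) : ℝ)) * Real.exp (-(δ * s⁻¹ * (η * dist₁ x x'))))) * 1
          * (C₂ * s' ^ (2 - ((d + 1 : ℕ) : ℝ)) * Real.exp (-(δ * s'⁻¹ * (η * dist₁ x x')))) * 1 := by
        gcongr
    _ = _ := by ring

/-- kernel: the pairing with the charge matrix: `|φ(x)·q(qR)| ≤ ‖φ(x)‖·Q²·‖R‖` when `‖qw‖ ≤ Q‖w‖`. [folklore] -/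
private theorem abs_inner_qq_le {Q : ℝ} (hQ : 0 ≤ Q) (q : W →ₗ[ℝ] W) (hq : ∀ w : W, ‖q w‖ ≤ Q * ‖w‖) (a R : W) :
    |⟪a, q (q R)⟫| ≤ ‖a‖ * (Q ^ 2 * ‖R‖) := by
  calc |⟪a, q (q R)⟫| ≤ ‖a‖ * ‖q (q R)‖ := abs_real_inner_le_norm _ _
    _ ≤ ‖a‖ * (Q ^ 2 * ‖R‖) := by
        refine mul_le_mul_of_nonneg_left ?_ (norm_nonneg _)
        calc ‖q (q R)‖ ≤ Q * ‖q R‖ := hq _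
          _ ≤ Q * (Q * ‖R‖) := mul_le_mul_of_nonneg_left (hq R) hQ
          _ = Q ^ 2 * ‖R‖ := by ring

/-- kernel: a constant dominating an absolute value through two positive factors is nonnegative. [folklore] -/
private theorem nonneg_of_abs_le_mul_mul {v C p e : ℝ} (h : |v| ≤ C * p * e) (hp : 0 < p) (he : 0 < e) : 0 ≤ C :=
  nonneg_of_mul_nonneg_left (nonneg_of_mul_nonneg_left ((abs_nonneg v).trans h) he) hp

/-- kernel: the summation step shared by (3.13) and (3.14) — a termwise bound `|t(x,x′)| ≤ K·b(x,x′)` sums to `|Σt| ≤ K·Σb`. [folklore] -/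
private theorem abs_sum_sum_le_of_termwise {Λ Λ' : Finset (Fin (d + 1) → ℤ)} {t b : KernelZ d} {K : ℝ}
    (h : ∀ x x', |t x x'| ≤ K * b x x') :
    |∑ x ∈ Λ, ∑ x' ∈ Λ', t x x'| ≤ K * ∑ x ∈ Λ, ∑ x' ∈ Λ', b x x' := by
  calc |∑ x ∈ Λ, ∑ x' ∈ Λ', t x x'| ≤ ∑ x ∈ Λ, |∑ x' ∈ Λ', t x x'| := Finset.abs_sum_le_sum_abs _ _
    _ ≤ ∑ x ∈ Λ, ∑ x' ∈ Λ', |t x x'| := Finset.sum_le_sum fun x _ => Finset.abs_sum_le_sum_abs _ _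
    _ ≤ ∑ x ∈ Λ, ∑ x' ∈ Λ', K * b x x' := Finset.sum_le_sum fun x _ => Finset.sum_le_sum fun x' _ => h x x'
    _ = K * ∑ x ∈ Λ, ∑ x' ∈ Λ', b x x' := by
        rw [Finset.mul_sum]
        exact Finset.sum_congr rfl fun x _ => by rw [Finset.mul_sum]

/-- **(3.13)** p. 436 [PDF 26] on `ηℤ^{d+1}`, POINTWISE form (before the localization into cubes), PROVED: under the (2.10)-type bounds
on the two kernels at the scales `s = L^jη`, `s′ = L^{j′}η`, `|g|, |g′| ≤ 1`, `‖qw‖ ≤ Q‖w‖` and the Hölder hypothesis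
`‖(∂^η_μφ′)(z) − (∂^η_μφ′)(z′)‖ ≤ H|z − z′|^α` (`0 ≤ α ≤ 1`), the expression (3.12) over any finite localization sets satisfies
`|(3.12)| ≤ (d+1)C₁C₂Q²H(2/δ + 8/δ²)·(m·m^α)·Σ_{x∈Λ,x′∈Λ′}η^{2(d+1)}‖φ(x)‖·s^{−(d+1)}e^{−½δ|x−x′|/s}·s′^{2−(d+1)}e^{−½δ|x−x′|/s′}`,
`m = min(s,s′) = L^{j₁}η` — the printed factors `(L^jη)^{−d}e^{−δ₀…}(L^{j′}η)^{−d+2}e^{−δ₀…}(L^{j₁}η)^{1+α}·[Hölder sup]` with `δ₀ = ½δ` and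
the dimension `d + 1` (twin of `B3Ineq313Pointwise.abs_term312_le`; the remainder enters through `B3Taylor310Lattice.norm_rem_le`).
[cite: Balaban1983Higgs3, (3.13) p.436] -/
theorem abs_term312Z_le (η : ℝ) (hη : 0 < η) {α H Q C₁ C₂ δ s s' : ℝ} (hα0 : 0 ≤ α) (hα1 : α ≤ 1) (hH : 0 ≤ H) (hQ : 0 ≤ Q)
    (hδ : 0 < δ) (hs : 0 < s) (hs' : 0 < s') (q : W →ₗ[ℝ] W) (hq : ∀ w : W, ‖q w‖ ≤ Q * ‖w‖)
    (Gj Gj' : KernelZ d) (g g' : (Fin (d + 1) → ℤ) → ℝ) (hg : ∀ x, |g x| ≤ 1) (hg' : ∀ x, |g' x| ≤ 1)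
    (hGj : ∀ (μ : Fin (d + 1)) (x x' : Fin (d + 1) → ℤ),
      |dKernelZ η⁻¹ μ Gj x x'| ≤ C₁ * s ^ (-((d + 1 : ℕ) : ℝ)) * Real.exp (-(δ * s⁻¹ * (η * dist₁ x x'))))
    (hGj' : ∀ x x' : Fin (d + 1) → ℤ,
      |Gj' x x'| ≤ C₂ * s' ^ (2 - ((d + 1 : ℕ) : ℝ)) * Real.exp (-(δ * s'⁻¹ * (η * dist₁ x x'))))
    (φ φ' : (Fin (d + 1) → ℤ) → W)
    (hφ' : ∀ (μ : Fin (d + 1)) (z z' : Fin (d + 1) → ℤ), ‖pd η⁻¹ μ φ' z - pd η⁻¹ μ φ' z'‖ ≤ H * (η * dist₁ z z') ^ α)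
    (Λ Λ' : Finset (Fin (d + 1) → ℤ)) :
    |term312Z η q Gj Gj' g g' φ φ' Λ Λ'| ≤
      (d + 1 : ℕ) * C₁ * C₂ * Q ^ 2 * H * (2 / δ + 8 / δ ^ 2) * (min s s' * (min s s') ^ α) *
        ∑ x ∈ Λ, ∑ x' ∈ Λ', η ^ (2 * (d + 1)) *
          (‖φ x‖ * (s ^ (-((d + 1 : ℕ) : ℝ)) * Real.exp (-(δ / 2 * s⁻¹ * (η * dist₁ x x'))))
            * (s' ^ (2 - ((d + 1 : ℕ) : ℝ)) * Real.exp (-(δ / 2 * s'⁻¹ * (η * dist₁ x x'))))) := by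
  have hC₁ : 0 ≤ C₁ := nonneg_of_abs_le_mul_mul (hGj 0 0 0) (Real.rpow_pos_of_pos hs _) (Real.exp_pos _)
  have hC₂ : 0 ≤ C₂ := nonneg_of_abs_le_mul_mul (hGj' 0 0) (Real.rpow_pos_of_pos hs' _) (Real.exp_pos _)
  have hHol : HolderDeriv η⁻¹ α H φ' := fun μ z z' => by simpa only [inv_inv] using hφ' μ z z'
  set K : ℝ := (d + 1 : ℕ) * C₁ * C₂ * Q ^ 2 * H * (2 / δ + 8 / δ ^ 2) * (min s s' * (min s s') ^ α) with hK
  unfold term312Z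
  refine abs_sum_sum_le_of_termwise fun x x' => ?_
  set u : ℝ := η * dist₁ x x' with hu
  have hu0 : 0 ≤ u := mul_nonneg hη.le (Nat.cast_nonneg _)
  -- the remainder: a differentiation of order 1 + α
  have hR : ‖rem η⁻¹ φ' x x'‖ ≤ H * u * u ^ α := by
    have h := norm_rem_le (inv_pos.mpr hη) hα0 hH hHol x x'
    rwa [inv_inv] at h
  have hinner : |⟪φ x, q (q (rem η⁻¹ φ' x x'))⟫| ≤ ‖φ x‖ * (Q ^ 2 * (H * u * u ^ α)) :=
    (abs_inner_qq_le hQ q hq _ _).trans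
      (mul_le_mul_of_nonneg_left (mul_le_mul_of_nonneg_left hR (sq_nonneg _)) (norm_nonneg _))
  have hcoeff := abs_coeff39Z_le hg hg' hGj hGj' x x'
  have hA : 0 ≤ ((d + 1 : ℕ) : ℝ) * (C₁ * s ^ (-((d + 1 : ℕ) : ℝ)) * Real.exp (-(δ * s⁻¹ * u))) := by positivity
  have hB : 0 ≤ C₂ * s' ^ (2 - ((d + 1 : ℕ) : ℝ)) * Real.exp (-(δ * s'⁻¹ * u)) := by positivity
  have hweight := exp_mul_weight_le hδ hs hs' hu0 hα0 hα1
  have hX : 0 ≤ η ^ (2 * (d + 1)) * ((d + 1 : ℕ) * C₁ * s ^ (-((d + 1 : ℕ) : ℝ)) * (C₂ * s' ^ (2 - ((d + 1 : ℕ) : ℝ))) *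
      (‖φ x‖ * Q ^ 2 * H)) := by positivity
  calc |η ^ (2 * (d + 1)) * (coeff39Z η Gj Gj' g g' x x' * ⟪φ x, q (q (rem η⁻¹ φ' x x'))⟫)|
      = η ^ (2 * (d + 1)) * (|coeff39Z η Gj Gj' g g' x x'| * |⟪φ x, q (q (rem η⁻¹ φ' x x'))⟫|) := by
        rw [abs_mul, abs_mul, abs_of_nonneg (by positivity : (0:ℝ) ≤ η ^ (2 * (d + 1)))]
    _ ≤ η ^ (2 * (d + 1)) * (((((d + 1 : ℕ) : ℝ) * (C₁ * s ^ (-((d + 1 : ℕ) : ℝ)) * Real.exp (-(δ * s⁻¹ * u)))) *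
          (C₂ * s' ^ (2 - ((d + 1 : ℕ) : ℝ)) * Real.exp (-(δ * s'⁻¹ * u)))) * (‖φ x‖ * (Q ^ 2 * (H * u * u ^ α)))) := by
        refine mul_le_mul_of_nonneg_left ?_ (by positivity)
        exact mul_le_mul hcoeff hinner (abs_nonneg _) (mul_nonneg hA hB)
    _ = η ^ (2 * (d + 1)) * ((d + 1 : ℕ) * C₁ * s ^ (-((d + 1 : ℕ) : ℝ)) * (C₂ * s' ^ (2 - ((d + 1 : ℕ) : ℝ))) *
          (‖φ x‖ * Q ^ 2 * H))
          * (Real.exp (-(δ * s⁻¹ * u)) * Real.exp (-(δ * s'⁻¹ * u)) * (u * u ^ α)) := by ring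
    _ ≤ η ^ (2 * (d + 1)) * ((d + 1 : ℕ) * C₁ * s ^ (-((d + 1 : ℕ) : ℝ)) * (C₂ * s' ^ (2 - ((d + 1 : ℕ) : ℝ))) *
          (‖φ x‖ * Q ^ 2 * H))
          * ((2 / δ + 8 / δ ^ 2) * (min s s' * (min s s') ^ α) *
            (Real.exp (-(δ / 2 * s⁻¹ * u)) * Real.exp (-(δ / 2 * s'⁻¹ * u)))) :=
        mul_le_mul_of_nonneg_left hweight hX
    _ = K * (η ^ (2 * (d + 1)) * (‖φ x‖ * (s ^ (-((d + 1 : ℕ) : ℝ)) * Real.exp (-(δ / 2 * s⁻¹ * u)))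
        * (s' ^ (2 - ((d + 1 : ℕ) : ℝ)) * Real.exp (-(δ / 2 * s'⁻¹ * u))))) := by rw [hK]; ring

/-- **(3.14)** p. 436 [PDF 26] on `ηℤ^{d+1}`, POINTWISE form, PROVED: as `abs_term312Z_le` but with — in place of the global Hölder
hypothesis — the LOCALIZED (2.11)-type two-point bound on the leg `φ′` around the position `x″` of the second leg of its propagator
`G_{(j″)}` (*"If φ′ is a leg of a propagator with an index j″, whose second leg is localized in Δ(v″), then the last supremum in (3.13) can
be estimated by O(1)(L^{j″}η)^{−d+1−α} sup_{x∈Δ(v),x′∈Δ(v′)} exp[−δ₀(L^{j″}η)^{−1}dist(Γ_{x,x′},Δ(v″))]"*; `hleg`, `C₃` for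
`O(1)(L^{j″}η)^{−d+1−α}`, `s″ = L^{j″}η ≥ max(s,s′)` — the lines `j, j′` are earlier than `j″`):
`|(3.12)| ≤ (d+1)C₁C₂C₃Q²(2/δ + 8/δ²)·(m·m^α)·Σ_{x∈Λ,x′∈Λ′}η^{2(d+1)}‖φ(x)‖·s^{−(d+1)}e^{−½δ|x−x′|/s}·s′^{2−(d+1)}e^{−½δ|x−x′|/s′}·e^{−½δ|x−x″|/s″}`
— *"the exponential factor together with another exponential factor in (3.13) give us the estimate"* (twin of
`B3Ineq314Local.abs_term312_le_local`, through `B3Taylor310Lattice.norm_rem_le_of_leg`; on `ℤ^{d+1}` no `η ≤ s″` is needed and the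
constant is `C₃` for p20's `8C₃e^{δ/2}`). [cite: Balaban1983Higgs3, (3.14) p.436] -/
theorem abs_term312Z_le_local (η : ℝ) (hη : 0 < η) {α Q C₁ C₂ C₃ δ s s' s'' : ℝ} (hα0 : 0 ≤ α) (hα1 : α ≤ 1) (hQ : 0 ≤ Q)
    (hC₃ : 0 ≤ C₃) (hδ : 0 < δ) (hs : 0 < s) (hs' : 0 < s') (hss : max s s' ≤ s'')
    (q : W →ₗ[ℝ] W) (hq : ∀ w : W, ‖q w‖ ≤ Q * ‖w‖)
    (Gj Gj' : KernelZ d) (g g' : (Fin (d + 1) → ℤ) → ℝ) (hg : ∀ x, |g x| ≤ 1) (hg' : ∀ x, |g' x| ≤ 1)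
    (hGj : ∀ (μ : Fin (d + 1)) (x x' : Fin (d + 1) → ℤ),
      |dKernelZ η⁻¹ μ Gj x x'| ≤ C₁ * s ^ (-((d + 1 : ℕ) : ℝ)) * Real.exp (-(δ * s⁻¹ * (η * dist₁ x x'))))
    (hGj' : ∀ x x' : Fin (d + 1) → ℤ,
      |Gj' x x'| ≤ C₂ * s' ^ (2 - ((d + 1 : ℕ) : ℝ)) * Real.exp (-(δ * s'⁻¹ * (η * dist₁ x x'))))
    (φ φ' : (Fin (d + 1) → ℤ) → W) (x'' : Fin (d + 1) → ℤ)
    (hleg : ∀ (μ : Fin (d + 1)) (z z' : Fin (d + 1) → ℤ), ‖pd η⁻¹ μ φ' z - pd η⁻¹ μ φ' z'‖ ≤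
      C₃ * (η * dist₁ z z') ^ α * Real.exp (-(δ * s''⁻¹ * (η * ((min (dist₁ z x'') (dist₁ z' x'') : ℕ) : ℝ)))))
    (Λ Λ' : Finset (Fin (d + 1) → ℤ)) :
    |term312Z η q Gj Gj' g g' φ φ' Λ Λ'| ≤
      (d + 1 : ℕ) * C₁ * C₂ * C₃ * Q ^ 2 * (2 / δ + 8 / δ ^ 2) * (min s s' * (min s s') ^ α) *
        ∑ x ∈ Λ, ∑ x' ∈ Λ', η ^ (2 * (d + 1)) *
          (‖φ x‖ * (s ^ (-((d + 1 : ℕ) : ℝ)) * Real.exp (-(δ / 2 * s⁻¹ * (η * dist₁ x x'))))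
            * (s' ^ (2 - ((d + 1 : ℕ) : ℝ)) * Real.exp (-(δ / 2 * s'⁻¹ * (η * dist₁ x x'))))
            * Real.exp (-(δ / 2 * s''⁻¹ * (η * dist₁ x x'')))) := by
  have hs'' : 0 < s'' := lt_of_lt_of_le (lt_max_of_lt_left hs) hss
  have hC₁ : 0 ≤ C₁ := nonneg_of_abs_le_mul_mul (hGj 0 0 0) (Real.rpow_pos_of_pos hs _) (Real.exp_pos _)
  have hC₂ : 0 ≤ C₂ := nonneg_of_abs_le_mul_mul (hGj' 0 0) (Real.rpow_pos_of_pos hs' _) (Real.exp_pos _)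
  have hleg' : ∀ (μ : Fin (d + 1)) (z z' : Fin (d + 1) → ℤ), ‖pd η⁻¹ μ φ' z - pd η⁻¹ μ φ' z'‖ ≤
      C₃ * (η⁻¹⁻¹ * (dist₁ z z' : ℝ)) ^ α *
        Real.exp (-(δ * s''⁻¹ * (η⁻¹⁻¹ * ((min (dist₁ z x'') (dist₁ z' x'') : ℕ) : ℝ)))) := fun μ z z' => by
    simpa only [inv_inv] using hleg μ z z'
  set K : ℝ := (d + 1 : ℕ) * C₁ * C₂ * C₃ * Q ^ 2 * (2 / δ + 8 / δ ^ 2) * (min s s' * (min s s') ^ α) with hK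
  unfold term312Z
  refine abs_sum_sum_le_of_termwise fun x x' => ?_
  set u : ℝ := η * dist₁ x x' with hu
  have hu0 : 0 ≤ u := mul_nonneg hη.le (Nat.cast_nonneg _)
  set E : ℝ := Real.exp (-(δ / 2 * s''⁻¹ * (η * dist₁ x x''))) with hE
  have hE0 : 0 ≤ E := (Real.exp_pos _).le
  -- the remainder through the localized (2.11)-type bound
  have hR : ‖rem η⁻¹ φ' x x'‖ ≤ C₃ * (u * u ^ α) * Real.exp (δ / 2 * s''⁻¹ * u) * E := by
    have h := norm_rem_le_of_leg (inv_pos.mpr hη) hα0 hC₃ hδ hs'' x'' hleg' x x'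
    simp only [inv_inv] at h
    exact h
  have hinner : |⟪φ x, q (q (rem η⁻¹ φ' x x'))⟫| ≤
      ‖φ x‖ * (Q ^ 2 * (C₃ * (u * u ^ α) * Real.exp (δ / 2 * s''⁻¹ * u) * E)) :=
    (abs_inner_qq_le hQ q hq _ _).trans
      (mul_le_mul_of_nonneg_left (mul_le_mul_of_nonneg_left hR (sq_nonneg _)) (norm_nonneg _))
  have hcoeff := abs_coeff39Z_le hg hg' hGj hGj' x x'
  have hA : 0 ≤ ((d + 1 : ℕ) : ℝ) * (C₁ * s ^ (-((d + 1 : ℕ) : ℝ)) * Real.exp (-(δ * s⁻¹ * u))) := by positivity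
  have hB : 0 ≤ C₂ * s' ^ (2 - ((d + 1 : ℕ) : ℝ)) * Real.exp (-(δ * s'⁻¹ * u)) := by positivity
  have hweight := exp_mul_weight_le_local hδ hs hs' hss hu0 hα0 hα1
  have hX : 0 ≤ η ^ (2 * (d + 1)) * ((d + 1 : ℕ) * C₁ * s ^ (-((d + 1 : ℕ) : ℝ)) * (C₂ * s' ^ (2 - ((d + 1 : ℕ) : ℝ))) *
      (‖φ x‖ * Q ^ 2 * C₃ * E)) := by positivity
  calc |η ^ (2 * (d + 1)) * (coeff39Z η Gj Gj' g g' x x' * ⟪φ x, q (q (rem η⁻¹ φ' x x'))⟫)|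
      = η ^ (2 * (d + 1)) * (|coeff39Z η Gj Gj' g g' x x'| * |⟪φ x, q (q (rem η⁻¹ φ' x x'))⟫|) := by
        rw [abs_mul, abs_mul, abs_of_nonneg (by positivity : (0:ℝ) ≤ η ^ (2 * (d + 1)))]
    _ ≤ η ^ (2 * (d + 1)) * (((((d + 1 : ℕ) : ℝ) * (C₁ * s ^ (-((d + 1 : ℕ) : ℝ)) * Real.exp (-(δ * s⁻¹ * u)))) *
          (C₂ * s' ^ (2 - ((d + 1 : ℕ) : ℝ)) * Real.exp (-(δ * s'⁻¹ * u)))) *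
          (‖φ x‖ * (Q ^ 2 * (C₃ * (u * u ^ α) * Real.exp (δ / 2 * s''⁻¹ * u) * E)))) := by
        refine mul_le_mul_of_nonneg_left ?_ (by positivity)
        exact mul_le_mul hcoeff hinner (abs_nonneg _) (mul_nonneg hA hB)
    _ = η ^ (2 * (d + 1)) * ((d + 1 : ℕ) * C₁ * s ^ (-((d + 1 : ℕ) : ℝ)) * (C₂ * s' ^ (2 - ((d + 1 : ℕ) : ℝ))) *
          (‖φ x‖ * Q ^ 2 * C₃ * E))
          * (Real.exp (-(δ * s⁻¹ * u)) * Real.exp (-(δ * s'⁻¹ * u)) * Real.exp (δ / 2 * s''⁻¹ * u) * (u * u ^ α)) := by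
        ring
    _ ≤ η ^ (2 * (d + 1)) * ((d + 1 : ℕ) * C₁ * s ^ (-((d + 1 : ℕ) : ℝ)) * (C₂ * s' ^ (2 - ((d + 1 : ℕ) : ℝ))) *
          (‖φ x‖ * Q ^ 2 * C₃ * E))
          * ((2 / δ + 8 / δ ^ 2) * (min s s' * (min s s') ^ α) *
            (Real.exp (-(δ / 2 * s⁻¹ * u)) * Real.exp (-(δ / 2 * s'⁻¹ * u)))) :=
        mul_le_mul_of_nonneg_left hweight hX
    _ = K * (η ^ (2 * (d + 1)) * (‖φ x‖ * (s ^ (-((d + 1 : ℕ) : ℝ)) * Real.exp (-(δ / 2 * s⁻¹ * u)))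
        * (s' ^ (2 - ((d + 1 : ℕ) : ℝ)) * Real.exp (-(δ / 2 * s'⁻¹ * u))) * E)) := by rw [hK]; ring

end Pointwise

/-! ## §4 Cubes of `ℤ^{d+1}` and the localization step `Σ_{x,x′}η^{2d} → Σ_{Δ(v),Δ(v′)}(L^{j₁}η)^{2d} sup` -/

section Cubes

/-- p. 436, *"We localize additionally the vertices in cubes Δ(v), Δ(v′), |Δ(v)| = |Δ(v′)| = (L^{j₁}η)^d"*: the label of the cube of
side `M` of `ℤ^{d+1}` containing `x` — coordinatewise `⌊x_μ/M⌋` (the paper: `M = L^{j₁}`; twin of `B3Ineq314Cubes.cubeIdx`).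
[cite: Balaban1983Higgs3, (3.13) p.436] -/
def cubeIdxZ (M : ℕ) (x : Fin (d + 1) → ℤ) : Fin (d + 1) → ℤ := fun μ => x μ / (M : ℤ)

/-- The cube labels met by a finite localization set `Λ` (the range of `Σ_{Δ(v)}` in (3.13) for fields localized in `Λ`).
[cite: Balaban1983Higgs3, (3.13) p.436] -/
def cubesZ (M : ℕ) (Λ : Finset (Fin (d + 1) → ℤ)) : Finset (Fin (d + 1) → ℤ) := Λ.image (cubeIdxZ M)

/-- The points of `Λ` in the cube with label `c` (`x ∈ Δ(v)`). [cite: Balaban1983Higgs3, (3.13) p.436] -/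
def fiberZ (M : ℕ) (Λ : Finset (Fin (d + 1) → ℤ)) (c : Fin (d + 1) → ℤ) : Finset (Fin (d + 1) → ℤ) :=
  Λ.filter fun x => cubeIdxZ M x = c

/-- Membership in a cube is having its label. [cite: Balaban1983Higgs3, (3.13) p.436] -/
@[simp] theorem mem_fiberZ {M : ℕ} {Λ : Finset (Fin (d + 1) → ℤ)} {c x : Fin (d + 1) → ℤ} :
    x ∈ fiberZ M Λ c ↔ x ∈ Λ ∧ cubeIdxZ M x = c := by
  simp [fiberZ]

/-- Every point of `Λ` lies in its own cube. [cite: Balaban1983Higgs3, (3.13) p.436] -/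
theorem mem_fiberZ_self (M : ℕ) {Λ : Finset (Fin (d + 1) → ℤ)} {x : Fin (d + 1) → ℤ} (hx : x ∈ Λ) :
    x ∈ fiberZ M Λ (cubeIdxZ M x) :=
  mem_fiberZ.mpr ⟨hx, rfl⟩

/-- The label of a point of `Λ` is one of the cube labels of `Λ`. [cite: Balaban1983Higgs3, (3.13) p.436] -/
theorem cubeIdxZ_mem_cubesZ (M : ℕ) {Λ : Finset (Fin (d + 1) → ℤ)} {x : Fin (d + 1) → ℤ} (hx : x ∈ Λ) :
    cubeIdxZ M x ∈ cubesZ M Λ :=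
  Finset.mem_image_of_mem _ hx

/-- A cube label of `Λ` has a nonempty cube. [cite: Balaban1983Higgs3, (3.13) p.436] -/
theorem fiberZ_nonempty {M : ℕ} {Λ : Finset (Fin (d + 1) → ℤ)} {c : Fin (d + 1) → ℤ} (hc : c ∈ cubesZ M Λ) :
    (fiberZ M Λ c).Nonempty := by
  obtain ⟨x, hx, rfl⟩ := Finset.mem_image.mp hc
  exact ⟨x, mem_fiberZ_self M hx⟩

/-- *"|Δ(v)| = (L^{j₁}η)^d"* as a count of lattice points: a cube of side `M` of `ℤ^{d+1}` has at most `M^{d+1}` points of `Λ`.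
[cite: Balaban1983Higgs3, (3.13) p.436] -/
theorem card_fiberZ_le {M : ℕ} (hM : 0 < M) (Λ : Finset (Fin (d + 1) → ℤ)) (c : Fin (d + 1) → ℤ) :
    (fiberZ M Λ c).card ≤ M ^ (d + 1) := by
  classical
  have hM0 : (M : ℤ) ≠ 0 := by exact_mod_cast hM.ne'
  have hMpos : (0 : ℤ) < M := by exact_mod_cast hM
  -- the remainders `x_μ mod M` separate the points of one cube
  let g : (Fin (d + 1) → ℤ) → (Fin (d + 1) → ℕ) := fun x μ => (x μ % (M : ℤ)).toNat
  have hmaps : ∀ x ∈ fiberZ M Λ c, g x ∈ Fintype.piFinset fun _ : Fin (d + 1) => Finset.range M := by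
    intro x _
    refine Fintype.mem_piFinset.mpr fun μ => Finset.mem_range.mpr ?_
    have h1 := Int.emod_nonneg (x μ) hM0
    have h2 := Int.emod_lt_of_pos (x μ) hMpos
    show (x μ % (M : ℤ)).toNat < M
    omega
  have hinj : Set.InjOn g ↑(fiberZ M Λ c) := by
    intro x hx y hy hxy
    have hx' : cubeIdxZ M x = c := (mem_fiberZ.mp hx).2
    have hy' : cubeIdxZ M y = c := (mem_fiberZ.mp hy).2
    funext μ
    have hq : x μ / (M : ℤ) = y μ / (M : ℤ) := by
      have h1 : x μ / (M : ℤ) = c μ := congrFun hx' μ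
      have h2 : y μ / (M : ℤ) = c μ := congrFun hy' μ
      rw [h1, h2]
    have hr : x μ % (M : ℤ) = y μ % (M : ℤ) := by
      have h : (x μ % (M : ℤ)).toNat = (y μ % (M : ℤ)).toNat := congrFun hxy μ
      have h1 := Int.emod_nonneg (x μ) hM0
      have h2 := Int.emod_nonneg (y μ) hM0
      omega
    calc x μ = (M : ℤ) * (x μ / (M : ℤ)) + x μ % (M : ℤ) := (Int.mul_ediv_add_emod _ _).symm
      _ = (M : ℤ) * (y μ / (M : ℤ)) + y μ % (M : ℤ) := by rw [hq, hr]
      _ = y μ := Int.mul_ediv_add_emod _ _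
  calc (fiberZ M Λ c).card ≤ (Fintype.piFinset fun _ : Fin (d + 1) => Finset.range M).card :=
        Finset.card_le_card_of_injOn g hmaps hinj
    _ = M ^ (d + 1) := by rw [Fintype.card_piFinset, Finset.prod_const, Finset.card_range, Finset.card_univ, Fintype.card_fin]

/-- `dist(Δ(v), Δ(v′))` of (3.13)/(3.14) in lattice steps: the least `ℓ¹` distance between a point of the cube `c` (side `M`) and a point
of the cube `c′` (side `M′`; the third cube `Δ(v″)` of (3.14) has its own size). [cite: Balaban1983Higgs3, (3.14) p.436] -/
def cdistZ (M M' : ℕ) (c c' : Fin (d + 1) → ℤ) : ℕ :=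
  sInf {n : ℕ | ∃ x x' : Fin (d + 1) → ℤ, cubeIdxZ M x = c ∧ cubeIdxZ M' x' = c' ∧ dist₁ x x' = n}

/-- The distance of two cubes is at most the distance of any two of their points. [cite: Balaban1983Higgs3, (3.14) p.436] -/
theorem cdistZ_le_dist₁ (M M' : ℕ) (x x' : Fin (d + 1) → ℤ) : cdistZ M M' (cubeIdxZ M x) (cubeIdxZ M' x') ≤ dist₁ x x' :=
  Nat.sInf_le ⟨x, x', rfl, rfl, rfl⟩

/-- kernel: the decay factors are monotone under `|x − x′| ↦ dist(Δ,Δ′)`: `e^{−a·η|x−x′|₁} ≤ e^{−a·η·dist(Δ(x),Δ′(x′))}` (`a, η ≥ 0`).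
[cite: Balaban1983Higgs3, (3.14) p.436] -/
theorem exp_dist₁_le_exp_cdistZ {a η : ℝ} (ha : 0 ≤ a) (hη : 0 ≤ η) (M M' : ℕ) (x x' : Fin (d + 1) → ℤ) :
    Real.exp (-(a * (η * dist₁ x x'))) ≤ Real.exp (-(a * (η * (cdistZ M M' (cubeIdxZ M x) (cubeIdxZ M' x') : ℝ)))) := by
  rw [Real.exp_le_exp, neg_le_neg_iff]
  have h : (cdistZ M M' (cubeIdxZ M x) (cubeIdxZ M' x') : ℝ) ≤ dist₁ x x' := by exact_mod_cast cdistZ_le_dist₁ M M' x x'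
  exact mul_le_mul_of_nonneg_left (mul_le_mul_of_nonneg_left h hη) ha

/-- kernel: a localized volume sum resolved along the cubes, `Σ_{x∈Λ} F(x) = Σ_{Δ} Σ_{x∈Λ∩Δ} F(x)`. [cite: Balaban1983Higgs3, (3.13) p.436] -/
theorem sum_eq_sum_cubesZ (M : ℕ) (Λ : Finset (Fin (d + 1) → ℤ)) (F : (Fin (d + 1) → ℤ) → ℝ) :
    ∑ x ∈ Λ, F x = ∑ c ∈ cubesZ M Λ, ∑ x ∈ fiberZ M Λ c, F x := by
  classical
  unfold fiberZ
  rw [Finset.sum_fiberwise_of_maps_to (fun x hx => cubeIdxZ_mem_cubesZ M hx)]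

/-- p. 436, the mechanism of *"We localize additionally the vertices in cubes Δ(v), Δ(v′) … (the expression (3.12)) ≦ O(1) Σ_{Δ(v),Δ(v′)}
sup_{x∈Δ(v)}|φ(x)| (L^{j₁}η)^{2d} …"* on `ηℤ^{d+1}`, PROVED for every cube side `M ≥ 1`: if `f ≥ 0` and the two-point weight satisfies
`0 ≤ w(x,x′) ≤ W(Δ(x),Δ(x′))` (a function of the cubes only), then `Σ_{x∈Λ,x′∈Λ′} η^{2(d+1)} f(x)w(x,x′) ≤ Σ_{Δ,Δ′} (Mη)^{2(d+1)} (sup_{x∈Λ∩Δ} f)·W(Δ,Δ′)`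
(twin of `B3Ineq314Cubes.sum_sum_le_cubes`). [cite: Balaban1983Higgs3, (3.13) p.436] -/
theorem sum_sum_le_cubesZ {M : ℕ} (hM : 0 < M) {η : ℝ} (hη : 0 ≤ η) (Λ Λ' : Finset (Fin (d + 1) → ℤ))
    (f : (Fin (d + 1) → ℤ) → ℝ) (hf : ∀ x, 0 ≤ f x) (w : KernelZ d) (hw0 : ∀ x x', 0 ≤ w x x')
    (Wc : (Fin (d + 1) → ℤ) → (Fin (d + 1) → ℤ) → ℝ) (hw : ∀ x x', w x x' ≤ Wc (cubeIdxZ M x) (cubeIdxZ M x')) :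
    ∑ x ∈ Λ, ∑ x' ∈ Λ', η ^ (2 * (d + 1)) * (f x * w x x') ≤
      ∑ c ∈ cubesZ M Λ, ∑ c' ∈ cubesZ M Λ',
        ((M : ℝ) * η) ^ (2 * (d + 1)) * (supOn (fiberZ M Λ c) f * Wc c c') := by
  classical
  have hres : ∑ x ∈ Λ, ∑ x' ∈ Λ', η ^ (2 * (d + 1)) * (f x * w x x') =
      ∑ c ∈ cubesZ M Λ, ∑ c' ∈ cubesZ M Λ', ∑ x ∈ fiberZ M Λ c, ∑ x' ∈ fiberZ M Λ' c',
        η ^ (2 * (d + 1)) * (f x * w x x') := by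
    rw [sum_eq_sum_cubesZ M Λ]
    refine Finset.sum_congr rfl fun c _ => ?_
    rw [Finset.sum_congr rfl fun x _ => sum_eq_sum_cubesZ M Λ' (fun x' => η ^ (2 * (d + 1)) * (f x * w x x')), Finset.sum_comm]
  rw [hres]
  refine Finset.sum_le_sum fun c hc => Finset.sum_le_sum fun c' hc' => ?_
  set S : ℝ := supOn (fiberZ M Λ c) f with hS
  have hS0 : 0 ≤ S := supOn_nonneg fun x _ => hf x
  have hterm : ∀ x ∈ fiberZ M Λ c, ∀ x' ∈ fiberZ M Λ' c',
      η ^ (2 * (d + 1)) * (f x * w x x') ≤ η ^ (2 * (d + 1)) * (S * Wc c c') := by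
    intro x hx x' hx'
    have hcx : cubeIdxZ M x = c := (mem_fiberZ.mp hx).2
    have hcx' : cubeIdxZ M x' = c' := (mem_fiberZ.mp hx').2
    have h1 : f x ≤ S := le_supOn f hx
    have h2 : w x x' ≤ Wc c c' := by rw [← hcx, ← hcx']; exact hw x x'
    exact mul_le_mul_of_nonneg_left (mul_le_mul h1 h2 (hw0 x x') hS0) (pow_nonneg hη _)
  obtain ⟨x₀, hx₀⟩ := fiberZ_nonempty hc
  obtain ⟨x₀', hx₀'⟩ := fiberZ_nonempty hc'
  have hB0 : 0 ≤ η ^ (2 * (d + 1)) * (S * Wc c c') :=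
    (mul_nonneg (pow_nonneg hη _) (mul_nonneg (hf x₀) (hw0 x₀ x₀'))).trans (hterm x₀ hx₀ x₀' hx₀')
  have hcard : ((fiberZ M Λ c).card : ℝ) ≤ (M : ℝ) ^ (d + 1) := by exact_mod_cast card_fiberZ_le hM Λ c
  have hcard' : ((fiberZ M Λ' c').card : ℝ) ≤ (M : ℝ) ^ (d + 1) := by exact_mod_cast card_fiberZ_le hM Λ' c'
  calc ∑ x ∈ fiberZ M Λ c, ∑ x' ∈ fiberZ M Λ' c', η ^ (2 * (d + 1)) * (f x * w x x')
      ≤ ∑ x ∈ fiberZ M Λ c, ∑ x' ∈ fiberZ M Λ' c', η ^ (2 * (d + 1)) * (S * Wc c c') :=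
        Finset.sum_le_sum fun x hx => Finset.sum_le_sum fun x' hx' => hterm x hx x' hx'
    _ = ((fiberZ M Λ c).card : ℝ) * (((fiberZ M Λ' c').card : ℝ) * (η ^ (2 * (d + 1)) * (S * Wc c c'))) := by
        simp only [Finset.sum_const, nsmul_eq_mul]
    _ ≤ (M : ℝ) ^ (d + 1) * ((M : ℝ) ^ (d + 1) * (η ^ (2 * (d + 1)) * (S * Wc c c'))) := by gcongr
    _ = ((M : ℝ) * η) ^ (2 * (d + 1)) * (S * Wc c c') := by ring

end Cubes

/-! ## §5 (3.13) and (3.14) in the printed cube-localized form on `ηℤ^{d+1}` -/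

section CubeForm

variable {W : Type*} [NormedAddCommGroup W] [InnerProductSpace ℝ W]

/-- **(3.13)** p. 436 [PDF 26] on `ηℤ^{d+1}` in its printed CUBE-LOCALIZED form, PROVED (every cube side `M ≥ 1`; the print: `M = L^{j₁}`,
`Mη = L^{j₁}η`): under the hypotheses of `abs_term312Z_le`,
`|(3.12)| ≤ (d+1)C₁C₂Q²H(2/δ+8/δ²)·(m·m^α)·Σ_{Δ,Δ′} (Mη)^{2(d+1)} sup_{x∈Λ∩Δ}‖φ(x)‖·s^{−(d+1)}e^{−½δ·η dist(Δ,Δ′)/s}·s′^{2−(d+1)}e^{−½δ·η dist(Δ,Δ′)/s′}`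
— the displayed `O(1) Σ_{Δ(v),Δ(v′)} sup_{x∈Δ(v)}|φ(x)|(L^{j₁}η)^{2d}(L^jη)^{−d}e^{…}(L^{j′}η)^{−d+2}e^{…}·(L^{j₁}η)^{1+α}·[Hölder sup]` with `δ₀ = ½δ`
(the middle factor `((L^{j₁}η)^{−1}dist(Δ(v),Δ(v′)))^{1+α}` — *"We can estimate the factor … by O(1) using half of the exponential factor
with index j₁"* — already spent; the Hölder supremum bounded by the global constant `H`; twin of `B3Ineq314Cubes.abs_term312_le_cubes`).
[cite: Balaban1983Higgs3, (3.13) p.436] -/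
theorem abs_term312Z_le_cubes (η : ℝ) (hη : 0 < η) {α H Q C₁ C₂ δ s s' : ℝ} (hα0 : 0 ≤ α) (hα1 : α ≤ 1) (hH : 0 ≤ H)
    (hQ : 0 ≤ Q) (hδ : 0 < δ) (hs : 0 < s) (hs' : 0 < s') (q : W →ₗ[ℝ] W) (hq : ∀ w : W, ‖q w‖ ≤ Q * ‖w‖)
    (Gj Gj' : KernelZ d) (g g' : (Fin (d + 1) → ℤ) → ℝ) (hg : ∀ x, |g x| ≤ 1) (hg' : ∀ x, |g' x| ≤ 1)
    (hGj : ∀ (μ : Fin (d + 1)) (x x' : Fin (d + 1) → ℤ),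
      |dKernelZ η⁻¹ μ Gj x x'| ≤ C₁ * s ^ (-((d + 1 : ℕ) : ℝ)) * Real.exp (-(δ * s⁻¹ * (η * dist₁ x x'))))
    (hGj' : ∀ x x' : Fin (d + 1) → ℤ,
      |Gj' x x'| ≤ C₂ * s' ^ (2 - ((d + 1 : ℕ) : ℝ)) * Real.exp (-(δ * s'⁻¹ * (η * dist₁ x x'))))
    (φ φ' : (Fin (d + 1) → ℤ) → W)
    (hφ' : ∀ (μ : Fin (d + 1)) (z z' : Fin (d + 1) → ℤ), ‖pd η⁻¹ μ φ' z - pd η⁻¹ μ φ' z'‖ ≤ H * (η * dist₁ z z') ^ α)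
    (Λ Λ' : Finset (Fin (d + 1) → ℤ)) {M : ℕ} (hM : 0 < M) :
    |term312Z η q Gj Gj' g g' φ φ' Λ Λ'| ≤
      (d + 1 : ℕ) * C₁ * C₂ * Q ^ 2 * H * (2 / δ + 8 / δ ^ 2) * (min s s' * (min s s') ^ α) *
        ∑ c ∈ cubesZ M Λ, ∑ c' ∈ cubesZ M Λ', ((M : ℝ) * η) ^ (2 * (d + 1)) *
          (supOn (fiberZ M Λ c) (fun x => ‖φ x‖) *
            ((s ^ (-((d + 1 : ℕ) : ℝ)) * Real.exp (-(δ / 2 * s⁻¹ * (η * (cdistZ M M c c' : ℝ))))) *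
              (s' ^ (2 - ((d + 1 : ℕ) : ℝ)) * Real.exp (-(δ / 2 * s'⁻¹ * (η * (cdistZ M M c c' : ℝ))))))) := by
  have hpt := abs_term312Z_le η hη hα0 hα1 hH hQ hδ hs hs' q hq Gj Gj' g g' hg hg' hGj hGj' φ φ' hφ' Λ Λ'
  have hC₁ : 0 ≤ C₁ := nonneg_of_abs_le_mul_mul (hGj 0 0 0) (Real.rpow_pos_of_pos hs _) (Real.exp_pos _)
  have hC₂ : 0 ≤ C₂ := nonneg_of_abs_le_mul_mul (hGj' 0 0) (Real.rpow_pos_of_pos hs' _) (Real.exp_pos _)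
  have hm : 0 < min s s' := lt_min hs hs'
  have hK : 0 ≤ (d + 1 : ℕ) * C₁ * C₂ * Q ^ 2 * H * (2 / δ + 8 / δ ^ 2) * (min s s' * (min s s') ^ α) := by positivity
  have hloc := sum_sum_le_cubesZ hM hη.le Λ Λ' (fun x => ‖φ x‖) (fun x => norm_nonneg _)
    (fun x x' => (s ^ (-((d + 1 : ℕ) : ℝ)) * Real.exp (-(δ / 2 * s⁻¹ * (η * dist₁ x x')))) *
      (s' ^ (2 - ((d + 1 : ℕ) : ℝ)) * Real.exp (-(δ / 2 * s'⁻¹ * (η * dist₁ x x')))))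
    (fun x x' => by positivity)
    (fun c c' => (s ^ (-((d + 1 : ℕ) : ℝ)) * Real.exp (-(δ / 2 * s⁻¹ * (η * (cdistZ M M c c' : ℝ))))) *
      (s' ^ (2 - ((d + 1 : ℕ) : ℝ)) * Real.exp (-(δ / 2 * s'⁻¹ * (η * (cdistZ M M c c' : ℝ))))))
    (fun x x' => mul_le_mul
      (mul_le_mul_of_nonneg_left (exp_dist₁_le_exp_cdistZ (by positivity) hη.le M M x x') (Real.rpow_pos_of_pos hs _).le)
      (mul_le_mul_of_nonneg_left (exp_dist₁_le_exp_cdistZ (by positivity) hη.le M M x x') (Real.rpow_pos_of_pos hs' _).le)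
      (by positivity) (by positivity))
  have hre : (∑ x ∈ Λ, ∑ x' ∈ Λ', η ^ (2 * (d + 1)) *
      (‖φ x‖ * (s ^ (-((d + 1 : ℕ) : ℝ)) * Real.exp (-(δ / 2 * s⁻¹ * (η * dist₁ x x'))))
        * (s' ^ (2 - ((d + 1 : ℕ) : ℝ)) * Real.exp (-(δ / 2 * s'⁻¹ * (η * dist₁ x x')))))) =
      ∑ x ∈ Λ, ∑ x' ∈ Λ', η ^ (2 * (d + 1)) *
        (‖φ x‖ * ((s ^ (-((d + 1 : ℕ) : ℝ)) * Real.exp (-(δ / 2 * s⁻¹ * (η * dist₁ x x')))) *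
          (s' ^ (2 - ((d + 1 : ℕ) : ℝ)) * Real.exp (-(δ / 2 * s'⁻¹ * (η * dist₁ x x')))))) :=
    Finset.sum_congr rfl fun x _ => Finset.sum_congr rfl fun x' _ => by ring
  rw [hre] at hpt
  exact hpt.trans (mul_le_mul_of_nonneg_left hloc hK)

/-- **(3.14)** p. 436 [PDF 26] on `ηℤ^{d+1}` AS PRINTED (cube-localized), PROVED for every pair of cube sides `M ≥ 1` (for `Δ(v), Δ(v′)`;
the print: `M = L^{j₁}`) and `M″` (for the cube `Δ(v″)` of the second leg `x″` of the propagator `G_{(j″)}` of the leg `φ′`): under the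
hypotheses of `abs_term312Z_le_local`,
`|(3.12)| ≤ (d+1)C₁C₂C₃Q²(2/δ+8/δ²)·(m·m^α)·Σ_{Δ,Δ′}(Mη)^{2(d+1)} sup_{x∈Λ∩Δ}‖φ(x)‖·s^{−(d+1)}e^{−½δ·η dist(Δ,Δ′)/s}·s′^{2−(d+1)}
e^{−½δ·η dist(Δ,Δ′)/s′}·e^{−½δ·η dist(Δ,Δ″)/s″}` — i.e. the displayed `O(1) Σ_{Δ(v),Δ(v′)} sup_{x∈Δ(v)}|φ(x)|(L^{j₁}η)^{2d}(L^jη)^{−d}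
exp[−½δ₀(L^jη)^{−1}dist(Δ(v),Δ(v′))](L^{j′}η)^{−d+2}exp[−½δ₀(L^{j′}η)^{−1}dist(Δ(v),Δ(v′))]·(L^{j₁}η)^{1+α}(L^{j″}η)^{−d+1−α}
exp[−½δ₀(L^{j″}η)^{−1}dist(Δ(v),Δ(v″))]` with `δ₀ = δ`, `C₃` for `O(1)(L^{j″}η)^{−d+1−α}` (twin of `B3Ineq314Cubes.abs_term312_le_local_cubes`).
[cite: Balaban1983Higgs3, (3.14) p.436] -/
theorem abs_term312Z_le_local_cubes (η : ℝ) (hη : 0 < η) {α Q C₁ C₂ C₃ δ s s' s'' : ℝ} (hα0 : 0 ≤ α) (hα1 : α ≤ 1)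
    (hQ : 0 ≤ Q) (hC₃ : 0 ≤ C₃) (hδ : 0 < δ) (hs : 0 < s) (hs' : 0 < s') (hss : max s s' ≤ s'')
    (q : W →ₗ[ℝ] W) (hq : ∀ w : W, ‖q w‖ ≤ Q * ‖w‖)
    (Gj Gj' : KernelZ d) (g g' : (Fin (d + 1) → ℤ) → ℝ) (hg : ∀ x, |g x| ≤ 1) (hg' : ∀ x, |g' x| ≤ 1)
    (hGj : ∀ (μ : Fin (d + 1)) (x x' : Fin (d + 1) → ℤ),
      |dKernelZ η⁻¹ μ Gj x x'| ≤ C₁ * s ^ (-((d + 1 : ℕ) : ℝ)) * Real.exp (-(δ * s⁻¹ * (η * dist₁ x x'))))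
    (hGj' : ∀ x x' : Fin (d + 1) → ℤ,
      |Gj' x x'| ≤ C₂ * s' ^ (2 - ((d + 1 : ℕ) : ℝ)) * Real.exp (-(δ * s'⁻¹ * (η * dist₁ x x'))))
    (φ φ' : (Fin (d + 1) → ℤ) → W) (x'' : Fin (d + 1) → ℤ)
    (hleg : ∀ (μ : Fin (d + 1)) (z z' : Fin (d + 1) → ℤ), ‖pd η⁻¹ μ φ' z - pd η⁻¹ μ φ' z'‖ ≤
      C₃ * (η * dist₁ z z') ^ α * Real.exp (-(δ * s''⁻¹ * (η * ((min (dist₁ z x'') (dist₁ z' x'') : ℕ) : ℝ)))))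
    (Λ Λ' : Finset (Fin (d + 1) → ℤ)) {M : ℕ} (M'' : ℕ) (hM : 0 < M) :
    |term312Z η q Gj Gj' g g' φ φ' Λ Λ'| ≤
      (d + 1 : ℕ) * C₁ * C₂ * C₃ * Q ^ 2 * (2 / δ + 8 / δ ^ 2) * (min s s' * (min s s') ^ α) *
        ∑ c ∈ cubesZ M Λ, ∑ c' ∈ cubesZ M Λ', ((M : ℝ) * η) ^ (2 * (d + 1)) *
          (supOn (fiberZ M Λ c) (fun x => ‖φ x‖) *
            ((s ^ (-((d + 1 : ℕ) : ℝ)) * Real.exp (-(δ / 2 * s⁻¹ * (η * (cdistZ M M c c' : ℝ))))) *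
              (s' ^ (2 - ((d + 1 : ℕ) : ℝ)) * Real.exp (-(δ / 2 * s'⁻¹ * (η * (cdistZ M M c c' : ℝ))))) *
              Real.exp (-(δ / 2 * s''⁻¹ * (η * (cdistZ M M'' c (cubeIdxZ M'' x'') : ℝ)))))) := by
  have hpt := abs_term312Z_le_local η hη hα0 hα1 hQ hC₃ hδ hs hs' hss q hq Gj Gj' g g' hg hg' hGj hGj' φ φ' x'' hleg Λ Λ'
  have hs'' : 0 < s'' := lt_of_lt_of_le (lt_max_of_lt_left hs) hss
  have hC₁ : 0 ≤ C₁ := nonneg_of_abs_le_mul_mul (hGj 0 0 0) (Real.rpow_pos_of_pos hs _) (Real.exp_pos _)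
  have hC₂ : 0 ≤ C₂ := nonneg_of_abs_le_mul_mul (hGj' 0 0) (Real.rpow_pos_of_pos hs' _) (Real.exp_pos _)
  have hm : 0 < min s s' := lt_min hs hs'
  have hK : 0 ≤ (d + 1 : ℕ) * C₁ * C₂ * C₃ * Q ^ 2 * (2 / δ + 8 / δ ^ 2) * (min s s' * (min s s') ^ α) := by positivity
  have hloc := sum_sum_le_cubesZ hM hη.le Λ Λ' (fun x => ‖φ x‖) (fun x => norm_nonneg _)
    (fun x x' => (s ^ (-((d + 1 : ℕ) : ℝ)) * Real.exp (-(δ / 2 * s⁻¹ * (η * dist₁ x x')))) *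
      (s' ^ (2 - ((d + 1 : ℕ) : ℝ)) * Real.exp (-(δ / 2 * s'⁻¹ * (η * dist₁ x x')))) *
      Real.exp (-(δ / 2 * s''⁻¹ * (η * dist₁ x x''))))
    (fun x x' => by positivity)
    (fun c c' => (s ^ (-((d + 1 : ℕ) : ℝ)) * Real.exp (-(δ / 2 * s⁻¹ * (η * (cdistZ M M c c' : ℝ))))) *
      (s' ^ (2 - ((d + 1 : ℕ) : ℝ)) * Real.exp (-(δ / 2 * s'⁻¹ * (η * (cdistZ M M c c' : ℝ))))) *
      Real.exp (-(δ / 2 * s''⁻¹ * (η * (cdistZ M M'' c (cubeIdxZ M'' x'') : ℝ)))))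
    (fun x x' => mul_le_mul (mul_le_mul
      (mul_le_mul_of_nonneg_left (exp_dist₁_le_exp_cdistZ (by positivity) hη.le M M x x') (Real.rpow_pos_of_pos hs _).le)
      (mul_le_mul_of_nonneg_left (exp_dist₁_le_exp_cdistZ (by positivity) hη.le M M x x') (Real.rpow_pos_of_pos hs' _).le)
      (by positivity) (by positivity))
      (exp_dist₁_le_exp_cdistZ (by positivity) hη.le M M'' x x'') (by positivity) (by positivity))
  have hre : (∑ x ∈ Λ, ∑ x' ∈ Λ', η ^ (2 * (d + 1)) *
      (‖φ x‖ * (s ^ (-((d + 1 : ℕ) : ℝ)) * Real.exp (-(δ / 2 * s⁻¹ * (η * dist₁ x x'))))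
        * (s' ^ (2 - ((d + 1 : ℕ) : ℝ)) * Real.exp (-(δ / 2 * s'⁻¹ * (η * dist₁ x x'))))
        * Real.exp (-(δ / 2 * s''⁻¹ * (η * dist₁ x x''))))) =
      ∑ x ∈ Λ, ∑ x' ∈ Λ', η ^ (2 * (d + 1)) *
        (‖φ x‖ * ((s ^ (-((d + 1 : ℕ) : ℝ)) * Real.exp (-(δ / 2 * s⁻¹ * (η * dist₁ x x')))) *
          (s' ^ (2 - ((d + 1 : ℕ) : ℝ)) * Real.exp (-(δ / 2 * s'⁻¹ * (η * dist₁ x x')))) *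
          Real.exp (-(δ / 2 * s''⁻¹ * (η * dist₁ x x''))))) :=
    Finset.sum_congr rfl fun x _ => Finset.sum_congr rfl fun x' _ => by ring
  rw [hre] at hpt
  exact hpt.trans (mul_le_mul_of_nonneg_left hloc hK)

end CubeForm

end

end Literature.MathematicalPhysics.QuantumFieldTheory.Balaban1983to89.B3Ineq313Lattice
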